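import Literature.MathematicalPhysics.QuantumFieldTheory.BalabanImbrieJaffe1984to88.BIJ88RT311Exists
import Literature.MathematicalPhysics.QuantumFieldTheory.BalabanImbrieJaffe1984to88.BIJ88Rho0Integrable
import Literature.MathematicalPhysics.QuantumFieldTheory.BalabanImbrieJaffe1984to88.BIJ85CellAverages

/-!
# `BalabanImbrieJaffe1984to88.BIJ85BlockAveragesTorus` — T. Bałaban, J. Imbrie, A. Jaffe, *Renormalization of the Higgs model:
minimizers, propagators and the stability of mean field theory*, Commun. Math. Phys. **97** (1985) 299–329 [BalabanImbrieJaffe1985],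
Chap. 2 pp. 302–303 and Sect. 3 p. 307: the CONCRETE `U(1)` block averages — the standard contours `Γ_{yx}` **(2.4)–(2.5)**, the
covariant scalar average `Q(u)φ` **(2.6)** with **(2.8)**, the nonlinear gauge-field average `Qu` **(2.10)** with the branch **(2.11)**,
and the surface substitution **(3.9)–(3.11)** — ON THE TORUS CARRIER OF RECORD, with the HAAR LAW of `Qu` PROVED; whence the
renormalized density `ρ₁^L` of T. Bałaban, J. Imbrie, A. Jaffe, *Effective action and cluster properties of the abelian Higgs model*,
Commun. Math. Phys. **114** (1988) 257–315 [BalabanImbrieJaffe1988] **(3.11)** EXISTS for the printed averages (no block-average hypothesis).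

statement-level skeleton of published theorems with citation tags; proofs where landed; nothing here is a claim about the Yang–Mills mass gap

PDF held: `paper:balaban1985-cmp97-bij-higgs-minimizers` (journal page = PDF page + 298); pp. 302–303 [PDF 4–5] and 306–307 [PDF 8–9]
read AS IMAGES this session (`HOME/lit-balaban-r15/pages/1985-cmp97-bij-higgs-minimizers-p004-x2.png`, `…-p008-x2.png`, `…-p009-x2.png`,
`pub-balaban/t4/b2b-balaban-t4-lit2/renders/bij1985/1985-cmp97-bij-higgs-minimizers-p005-x2.png`); [BalabanImbrieJaffe1988] p. 266
[PDF 10] (`HOME/lit-balaban-r18/renders/c2/c2-p010b.png`).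

CITATION HEADER (lean-in-tree rule).  Part of the lit-balaban TYPED SKELETON (HOME `run/shared/lean/pub/lit-balaban/`), unit
`lit-balaban-r18` gen 4 (READER/TYPER r18: cross-paper DEFINITIONS — *averaging operators Q, block fields* — and fold owner of C2
Sects. 1–4; TAKING line HOME/STATUS.md 2026-08-21T03:58Z).  WHAT IS REPRODUCED: rows `C1.Eq2.6`, `C1.Eq2.8`, `C1.Eq2.10-2.11`,
`C1.Eq3.9-3.12` of `HOME/lit-balaban-r15/ROWS-C1.md` (owner r15) as the TORUS member of a carrier pair whose `ℤ^d` members are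
the decls of record of Phase-2 seat p03 (`BIJ85AxialGauge34.contour/hol`, `BIJ85AxialGauge35.qCov/run/loop210/qU`; (3.9)–(3.11)
`BIJ85Eq311Proof`, filed) — nothing of p03's is re-declared or restated on its carrier; and rows `C2.Eq3.11` / `C2.Eq3.13` of
`HOME/lit-balaban-r18/ROWS-C2.md` (this unit), whose block-average DATA `Qu`, `Q(u)φ` (`BIJ88RenormTransf311.IsRT311`, r18 gen 3)
and Haar-regularity HYPOTHESIS `hac` (`BIJ88RT311Exists.axialRTData`, seat p34 gen 2; cell file GAPS.md G-C2-04, *"open follow-up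
(any seat): the torus instance … of (2.10) with the Haar-compatibility proof, discharging `ac_qU`"*) are instantiated and
discharged here.

THE PRINTED TEXT (verbatim).  p. 302 [PDF 4]: *"Imbed the unit lattice in an L-lattice of block B(y). Here y = Ln denotes a corner of
a block, and n ∈ Z^d. Then B(y) consists of points x = (x₁, …, x_d) such that Ln_j ≦ x_j < L(n_j + 1), j = 1, 2, …, d. (2.4) Let Γ
denote a path (contour) composed of bonds, and define u(Γ) = Π_{b∈Γ} u_b. (2.5) … We require a set of standard contours Γ_{yx}
from corners y of blocks B(y) to points x ∈ B(y). Define Γ_{yx} as the path obtained by following the coordinate axis one, then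
axis two, …, etc., in going from x to y."*; p. 303 [PDF 5]: *"For a point y′ which is a corner of an adjacent block, let Γ_{yy′}
denote the L-lattice bond from y to y′. The average Qφ of φ is defined by (Qφ)_y = L^{−d} Σ_{x∈B(y)} u(Γ_{yx})φ_x. (2.6) An important
property of the average is that Q commutes with gauge transformations. In other words, let h denote a map from the unit lattice to
U(1). Then h defines the gauge transformation φ_y → h(y)φ_y ≡ φ^h_y, u_b → h(b₋)h(b₊)^{−1}u_b = u^h_b. (2.7) Clearly (Qφ)^h = Qφ^h.
(2.8) … In the axial gauge, Qφ reduces to the ordinary average of φ … Let us next consider the average of a gauge field u. If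
b′ = yy′ is a bond on the L-lattice, then Γ_{yy′} = b′ and we average over contours Γ_{xx′} which are translates of Γ_{yy′}, i.e.
x − x′ = y − y′. More specifically, define Q on gauge fields on the unit lattice by (Qu)_{yy′} = u(Γ_{yy′}) exp[L^{−d} Σ_{x∈B(y)}
ln u(Γ_{yx} ∘ Γ_{xx′} ∘ Γ_{y′x′}^{−1} ∘ Γ_{y′y})]. (2.10) In (2.10) choose the logarithm so that −π ≦ arg ln u < π. (2.11)"*;
p. 307 [PDF 9]: *"First define a unit lattice field u′_b with block averages equal to 1. … Let (u′)_b = u_b, if b ∉ B^s(b′),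
u_bv_{b′}^{−1}, if b ∈ B^s(b′) (3.9) be given in terms of the averaging operator Q of (2.10), where v_{b′} = (Qu)_{b′}. (3.10) It then
follows that (Qu′)_{b′} = 1 (3.11) for all L-lattice bonds b′."*; [BalabanImbrieJaffe1988] p. 266: *"ρ₁^L(v, ψ) = ∫𝒟u𝒟φ δ(v/Qu)δ_{Ax}(u)F
exp[…]. (3.11) … the block fields v, ψ on the L-lattice … U(1) averages Q of [2, Chap. 2]"*.

CARRIERS (all of record; nothing re-declared).  The unit lattice `T₁` = the torus `Balaban1983to89.Site P j` of `Setup`, the `L`-lattice =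
`Site P (j+1)`, blocks `block y = {x | blockOf x = y}` (the block over the coarse label `n` consists of the fine labels `nL, …, nL + L − 1`
coordinatewise, `Site.blockSite`; its CORNER (2.4) is the lowest label `nL` = `corner y`; standing range `j + 1 ≤ m + K` of `Params`);
positively oriented unit bonds `PBond P j = ⟨x, x + e_μ⟩`; `U(1) = BIJ88Sect3Statements.U1` read in `ℂ` through `toC`; gauge fields
`GaugeField P j U1` with the product Haar probability measure `fieldMeasure` (`𝒟u`), scalar fields `HiggsField P j = Site P j → ℂ`; the gauge
transformation (2.7) of the gauge field is `Setup`'s `GaugeField.gaugeAct`, of the scalar field `φ ↦ (x ↦ h(x)φ(x))` (= `BIJ85RT33.twist`).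
The axial gauge `δ_{Ax}` of (3.4) on this carrier is r18 gen 3's `BIJ88RenormTransf311.IsAxialBond/axialBonds/axialMeasure`, and the comb
geometry below is THE SAME: every bond of `Γ_{yx}` is one of those tree bonds (`isAxialBond_legBond`).

WHAT IS DEFINED (defs with bodies) / PROVED (0 `sorry`, standard axioms, no `Prop`-valued fact introduced).
* §1 block geometry in the standing range: `corner`, in-block offsets `offs` (`blockSite_offs`: `x = blockSite (blockOf x) (offs x)`).
* §2 **(2.4)–(2.5)** the standard contour `Γ_{yx}`: from the corner `y` of `B(y)` to `x ∈ B(y)`, the HIGHEST axis first (the print runs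
  the axes in increasing order *"in going from x to y"*), leg by leg: `legSite x μ t` / `legBond x μ t` (`t < offs x μ`), and the `U(1)`
  transport `holC U x = u(Γ_{yx}) = Π_{b∈Γ_{yx}} u_b ∈ ℂ` (`legProd` per leg).  PROVED: the legs are consecutive (`legSite_shift`), every bond of
  `Γ_{yx}` is a tree bond of (3.4) (`isAxialBond_legBond`), hence **in the axial gauge `u(Γ_{yx}) = 1`** (`holC_of_deltaAx`), and the
  telescoping of (2.7) along `Γ_{yx}`: `u^h(Γ_{yx}) = h(y)u(Γ_{yx})h(x)^{−1}` (`holC_gaugeAct`).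
* §3 **(2.6)** `qCov U φ y = L^{−d} Σ_{x∈B(y)} u(Γ_{yx})φ(x)`; **(2.8)** `(Qφ)^h = Qφ^h` PROVED (`qCov_gaugeAct`: `Q(u^h)φ^h = h(y)·Q(u)φ` with `h`
  at the corner); p. 303 *"In the axial gauge, Qφ reduces to the ordinary average of φ"* PROVED (`qCov_of_deltaAx`).
* §4 **(2.10)–(2.11)**: the straight runs `Γ_{xx′}` (`runSite`/`runBond`, `runC U x μ = u([x, x + Le_μ])`), the closed contour
  `loopC U c x = u(Γ_{yx})u(Γ_{xx′})u(Γ_{y′x′})^{−1}u(Γ_{yy′})^{−1}` (`y′ = y + Le_μ`, `x′ = x + Le_μ`; `Γ^{−1}` = inverse transport), the branch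
  (2.11) `ln u = i·argB u` with `−π ≤ argB < π` = `BIJ85Sect1Model.argB` (decl of record of row C1.Eq2.10-2.11), and
  **`qU U c = (Qu)_{yy′} ∈ U(1)`** (`toC_qU`: `toC (qU U c) = u(Γ_{yy′})·exp[L^{−d}Σ_{x∈B(y)} ln u(loop)]`, the display (2.10)).  PROVED: the loop
  is gauge INVARIANT and `Q` commutes with gauge transformations also on gauge fields, `Q(u^h) = (Qu)^{h∘corner}` (`qU_gaugeAct`; the
  `L`-lattice transformation acts by `h` at the block corners), measurability (`measurable_qU`, `measurable_qCov`).
* §5 **(3.9)–(3.11)**: surface bonds `IsCross b` (`b₊` leaves the block of `b₋`: `blockOf_tgt_of_isCross` = *"b ∈ B^s(b′)"* (2.15) with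
  `b′ = coarse b`), the substitution `surfMul U w` = `u_b ↦ u_bw_{b′}` on `B^s(b′)` (so (3.9) `uPrime U = surfMul U (Qu)^{−1}`), and
  **`Q(u·w) = (Qu)·w`** (`qU_surfMul`: each loop of (2.10) crosses the face of `b′` once forwards in `Γ_{xx′}` and once backwards in `Γ_{y′y}`
  and is unchanged, the prefactor `u(Γ_{yy′})` picks up `w_{b′}` — for ANY choice of the logarithm), hence **(3.11) `Q(u′) = 1`**
  (`qU_uPrime`).
* §6 **THE HAAR LAW of (2.10)**: `(𝒟u).map Q = 𝒟v` (`map_qU_fieldMeasure`) and, in the axial gauge of (3.4),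
  **`(∫𝒟u δ_{Ax}(u)·).map Q = 𝒟v`** (`map_qU_axialMeasure`) — `u ↦ u·w` preserves `𝒟u` (`AveragingRT.measurePreserving_mulRight`) and commutes with
  the freezing of the (intra-block) tree bonds (`fixBonds_surfMul`), so the law of `Qu` is a translation-invariant probability measure on
  the compact group `U(1)^{T_L-bonds}`, i.e. Haar measure (`AveragingRT.measure_eq_mass_smul_of_invariant`; the argument recorded in GAPS.md
  G-C2-04 and in the header of `BIJ85RT33`).  Consequently the Haar-regularity hypothesis `hac`/`ac_qU` of `BIJ88RT311Exists.axialRTData` /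
  `BIJ85RT33.RTData` holds for the printed averages (`absolutelyContinuous_map_qU`), and:
* §7 **(3.11) of [BalabanImbrieJaffe1988] for the printed block averages**: `torusRTData` = the block-averaging datum with `Qu` = (2.10), `Q(u)φ`
  = (2.6), `δ_{Ax}` = (3.4) (`axialBonds`); `isRT311_model`: for `a > 0`, `d ≥ 2` and every jointly measurable, jointly gauge-invariant,
  `𝒟u𝒟φ`-integrable density `ρ₀`, the Radon–Nikodym transform `ρ₁ := 𝒯ρ₀` of [BalabanImbrieJaffe1985] (3.3) (p34's `RTData.rt`) satisfies r18's
  `IsRT311 qU qCov a ρ₀ ρ₁` — NO hypothesis on the block averages remains (`exists_isRT311`); and (3.13) for it, `eq313_model`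
  (r18's `eq313` ∘ p34's `eq313_rt`).
NOT DONE HERE (honest scope).  (2.9) `QQ^* = I` for (2.6) is r15's abstract `BIJ85CellAverages.Cells.Qcov_QcovStar` (the torus `Cells` instance is
not built here); (2.12)–(2.24) (the linear averages `Q^s`, `Q^e`) are r15's `BIJ85Sect2SurfaceAverages`/`BIJ85CellAverages`; the
`𝒟u𝒟φ`-integrability of the model density `rho0` stays a hypothesis of `eq313_model` as in `BIJ88RT311Exists.eq313_rt`.  Imports:
`BIJ88RT311Exists` only (Literature + Mathlib); standard axioms.

v1.1 (append-only, same seat): §8 — (a) **(2.9) `QQ^* = I` for the CONCRETE (2.6) on the torus**: the two-scale cell geometry of r15's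
`BIJ85CellAverages.Cells` instantiated by the torus sites (`torusCells`: fine cells `Site P j`, coarse cells `Site P (j+1)`, `cell x = B(x)`,
`m = 0`), `qCov = Cells.Qcov` with the unit transports `holCircle U x = u(Γ_{yx}) ∈ U(1)` (`qCov_eq_cellsQcov`), hence (2.9) `qCov_qCovStar`
(from r15's `Cells.Qcov_QcovStar` and `|B(y)| = L^d`, `Site.card_block`) and the adjointness `inner_qCov_eq_inner_qCovStar`; (b) **(3.11)/(3.13) of
[BalabanImbrieJaffe1988] with ALL analytic hypotheses discharged for the printed model and the observables of (3.1)** — `isRT311_printed`,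
`eq313_printed`: block averages (2.6)/(2.10) (this file), existence (p34's `RTData.rt`), integrability of `ρ₀` (r18's
`BIJ88Rho0Integrable.integrable_rho0`, for `|F(u, φ)| ≤ CΠ_x(1 + |φ(x)|)ⁿ`); the only premises left are the printed ones: `ε > 0`, `λ > 0`,
`a > 0`, `d ≥ 2`, `F` jointly measurable and *"a gauge invariant function of u, φ"* (p. 265).  v1.1 adds the imports `BIJ88Rho0Integrable`,
`BIJ85CellAverages`; nothing of v1 is changed.
-/

namespace Literature.MathematicalPhysics.QuantumFieldTheory.BalabanImbrieJaffe1984to88.BIJ85BlockAveragesTorus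

open Literature.MathematicalPhysics.QuantumFieldTheory.Balaban1983to89
open BIJ88Sect3Statements (U1 toC toC_mul toC_one toC_inv norm_toC bracket actionU1)
open BIJ88Sect3Rescaling (circleEquivU1 toC_circleEquivU1 coe_circleEquivU1_symm toC_injective_U1)
open BIJ85Sect1Model (HiggsField argB argB_mem_Ico exp_argB)
open BIJ85RT33 (JointInvariant measurable_toC)
open BIJ88RenormTransf311 (inBlock IsAxialBond axialBonds mem_axialBonds DeltaAx axialMeasure IsRT311 rho0)
open BIJ88RT311Exists (axialRTData gaussApprox isRT311_axialRTData eq313_rt integrable_rt_of_integrable_ax)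
open Literature.MathematicalPhysics.QuantumLattice (u1Rep continuous_u1Rep u1Rep_mem_unitaryGroup)
open T4AxialGaugeFixing (fixBonds measurable_fixBonds fixBonds_apply_of_mem fixBonds_apply_of_not_mem)
open GaugeField (gaugeAct GaugeInvariant)
open scoped BigOperators
open _root_.MeasureTheory Complex Finset

noncomputable section

variable {P : Params} {j : ℕ}

/-! ## §0 `U(1)` plumbing: inverses in `ℂ`, the branch (2.11), and `θ ↦ e^{iθ} ∈ U(1)` -/

/-- kernel: the reversed bond carries the inverse variable, read in `ℂ`: `toC g⁻¹ = (toC g)⁻¹` (p. 300 *"u_b^{−1} = u_{b^{−1}}"*).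
[cite: BalabanImbrieJaffe1985, (2.5) p.302] -/
theorem toC_inv' (g : U1) : toC g⁻¹ = (toC g)⁻¹ := by
  apply eq_inv_of_mul_eq_one_left
  rw [← toC_mul, inv_mul_cancel, toC_one]

/-- kernel: a `U(1)` variable is a non-zero complex number. [cite: BalabanImbrieJaffe1985, (2.5) p.302] -/
theorem toC_ne_zero (g : U1) : toC g ≠ 0 := fun h => by simpa [h] using norm_toC g

/-- kernel: the gauge transformation (2.7) of a bond variable read in `ℂ`: `u^h_b = h(b₋)u_bh(b₊)^{−1}`.
[cite: BalabanImbrieJaffe1985, (2.7) p.303] -/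
theorem toC_gaugeAct (h : GaugeTransf P j U1) (U : GaugeField P j U1) (b : PBond P j) :
    toC (gaugeAct h U b) = toC (h b.src) * toC (U b) * (toC (h b.tgt))⁻¹ := by
  show toC (h b.src * U b * (h b.tgt)⁻¹) = _
  rw [toC_mul, toC_mul, toC_inv']

/-- kernel: the branch (2.11) inverts the exponential on `U(1)`: `exp(i·argB u) = u` for a bond variable `u`.
[cite: BalabanImbrieJaffe1985, (2.11) p.303] -/
theorem exp_argB_toC (g : U1) : Complex.exp (argB (toC g) * I) = toC g := by
  have h := exp_argB (circleEquivU1.symm g)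
  rwa [coe_circleEquivU1_symm] at h

/-- kernel: the branch (2.11) `argB` (`−π ≤ argB < π`) is a measurable function on `ℂ`. [cite: BalabanImbrieJaffe1985, (2.11) p.303] -/
theorem measurable_argB : Measurable argB := by
  unfold argB
  exact Measurable.ite (measurableSet_eq_fun Complex.measurable_arg measurable_const) measurable_const
    Complex.measurable_arg

/-- The element `e^{iθ} ∈ U(1)` (the exponential of (2.10) lands in `U(1)`; via C1's `Circle` and the dictionary `circleEquivU1`).
[cite: BalabanImbrieJaffe1985, (2.10) p.303] -/
def expU1 (θ : ℝ) : U1 := circleEquivU1 (Circle.exp θ)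

/-- kernel: `toC (e^{iθ}) = exp(iθ)`. [cite: BalabanImbrieJaffe1985, (2.10) p.303] -/
theorem toC_expU1 (θ : ℝ) : toC (expU1 θ) = Complex.exp (θ * I) := by
  rw [expU1, toC_circleEquivU1, Circle.coe_exp]

/-- kernel: `θ ↦ e^{iθ} ∈ U(1)` is continuous. [cite: BalabanImbrieJaffe1985, (2.10) p.303] -/
theorem continuous_expU1 : Continuous expU1 :=
  (show Continuous (circleEquivU1 : Circle → U1) from continuous_u1Rep.subtype_mk _).comp Circle.exp.continuous

/-- kernel: `θ ↦ e^{iθ} ∈ U(1)` is measurable. [cite: BalabanImbrieJaffe1985, (2.10) p.303] -/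
theorem measurable_expU1 : Measurable expU1 := continuous_expU1.measurable

/-- kernel: a telescoping product in `ℂ`: `Π_{t<n} f(t)u(t)f(t+1)^{−1} = f(0)(Π u)f(n)^{−1}` (the mechanism of (2.8)). [folklore] -/
private theorem prod_range_telescope (f : ℕ → ℂ) (hf : ∀ t, f t ≠ 0) (u : ℕ → ℂ) (n : ℕ) :
    ∏ t ∈ range n, (f t * u t * (f (t + 1))⁻¹) = f 0 * (∏ t ∈ range n, u t) * (f n)⁻¹ := by
  induction n with
  | zero => simp [mul_inv_cancel₀ (hf 0)]
  | succ n ih =>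
    rw [prod_range_succ, prod_range_succ, ih,
      show f 0 * (∏ t ∈ range n, u t) * (f n)⁻¹ * (f n * u n * (f (n + 1))⁻¹)
        = f 0 * ((∏ t ∈ range n, u t) * u n) * (f (n + 1))⁻¹ * ((f n)⁻¹ * f n) by ring,
      inv_mul_cancel₀ (hf n), mul_one]

/-- kernel: `(Π_{i<n} f(i+1))·(Π_{i<n} f(i)^{−1}) = f(n)f(0)^{−1}`. [folklore] -/
private theorem prod_succ_mul_prod_inv (f : ℕ → ℂ) (hf : ∀ i, f i ≠ 0) (n : ℕ) :
    (∏ i ∈ range n, f (i + 1)) * (∏ i ∈ range n, (f i)⁻¹) = f n * (f 0)⁻¹ := by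
  induction n with
  | zero => simp [mul_inv_cancel₀ (hf 0)]
  | succ n ih =>
    rw [prod_range_succ, prod_range_succ, mul_mul_mul_comm, ih,
      show f n * (f 0)⁻¹ * (f (n + 1) * (f n)⁻¹) = f (n + 1) * (f 0)⁻¹ * (f n * (f n)⁻¹) by ring,
      mul_inv_cancel₀ (hf n), mul_one]

/-! ## §1 Blocks and corners on the torus of record (standing range `j + 1 ≤ m + K`) -/

/-- kernel: membership in a block. [cite: BalabanImbrieJaffe1985, (2.4) p.302] -/
theorem mem_block_iff {x : Balaban1983to89.Site P j} {y : Balaban1983to89.Site P (j+1)} : x ∈ block y ↔ blockOf x = y := by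
  simp [block]

/-- **(2.4)** *"Here y = Ln denotes a corner of a block"*: the CORNER of the block over the coarse label `y` is the fine site of lowest
label `yL` in every direction (`Balaban1983to89.Site.blockSite y 0`). [cite: BalabanImbrieJaffe1985, (2.4) p.302] -/
def corner (y : Balaban1983to89.Site P (j+1)) : Balaban1983to89.Site P j := Balaban1983to89.Site.blockSite y (fun _ => ⟨0, P.L_pos⟩)

/-- kernel: the label of the corner is `yL`. [cite: BalabanImbrieJaffe1985, (2.4) p.302] -/
theorem val_corner (hj : j + 1 ≤ P.m + P.K) (y : Balaban1983to89.Site P (j+1)) (κ : Fin P.d) : (corner y κ).val = (y κ).val * P.L := by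
  rw [corner, Balaban1983to89.Site.val_blockSite hj]
  simp

/-- kernel: the corner lies in its block, `blockOf (corner y) = y`. [cite: BalabanImbrieJaffe1985, (2.4) p.302] -/
theorem blockOf_corner (hj : j + 1 ≤ P.m + P.K) (y : Balaban1983to89.Site P (j+1)) : blockOf (corner y) = y :=
  Balaban1983to89.Site.blockOf_blockSite hj y _

/-- kernel: `corner y ∈ B(y)`. [cite: BalabanImbrieJaffe1985, (2.4) p.302] -/
theorem corner_mem_block (hj : j + 1 ≤ P.m + P.K) (y : Balaban1983to89.Site P (j+1)) : corner y ∈ block y :=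
  mem_block_iff.2 (blockOf_corner hj y)

/-- kernel: the corner has in-block position `0` in every direction. [cite: BalabanImbrieJaffe1985, (2.4) p.302] -/
theorem inBlock_corner (hj : j + 1 ≤ P.m + P.K) (y : Balaban1983to89.Site P (j+1)) (κ : Fin P.d) : inBlock (corner y) κ = 0 := by
  rw [inBlock, val_corner hj, Nat.mul_mod_left]

/-- The offsets `(x₁ − Ln₁, …, x_d − Ln_d) ∈ {0, …, L−1}^d` of `x` inside its block ((2.4): `Ln_j ≦ x_j < L(n_j + 1)`), i.e. the numbers
`n_i` of the contour `Γ_{yx}` (p. 302: `x − y = Σ n_ie_i`). [cite: BalabanImbrieJaffe1985, (2.4) p.302] -/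
def offs (x : Balaban1983to89.Site P j) : Fin P.d → Fin P.L := fun κ => ⟨inBlock x κ, Nat.mod_lt _ P.L_pos⟩

/-- kernel: `offs x κ = inBlock x κ` as a number. [cite: BalabanImbrieJaffe1985, (2.4) p.302] -/
@[simp] theorem coe_offs (x : Balaban1983to89.Site P j) (κ : Fin P.d) : ((offs x κ : Fin P.L) : ℕ) = inBlock x κ := rfl

/-- kernel: the in-block position of `blockSite y r` is `r`. [cite: BalabanImbrieJaffe1985, (2.4) p.302] -/
theorem inBlock_blockSite (hj : j + 1 ≤ P.m + P.K) (y : Balaban1983to89.Site P (j+1)) (r : Fin P.d → Fin P.L) (κ : Fin P.d) :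
    inBlock (Balaban1983to89.Site.blockSite y r) κ = r κ := by
  rw [inBlock, Balaban1983to89.Site.val_blockSite hj, Nat.mul_add_mod', Nat.mod_eq_of_lt (r κ).isLt]

/-- kernel: **`x = y + Σ n_ie_i`** — a site is the site of its block with its offsets. [cite: BalabanImbrieJaffe1985, (2.4) p.302] -/
theorem blockSite_offs (hj : j + 1 ≤ P.m + P.K) (x : Balaban1983to89.Site P j) : Balaban1983to89.Site.blockSite (blockOf x) (offs x) = x := by
  funext κ
  apply ZMod.val_injective
  rw [Balaban1983to89.Site.val_blockSite hj, Balaban1983to89.Site.val_blockOf hj, coe_offs, inBlock]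
  exact Nat.div_add_mod' _ _

/-- kernel: the coordinate of `x` is `corner + offset` in `ZMod`. [cite: BalabanImbrieJaffe1985, (2.4) p.302] -/
theorem corner_add_inBlock (hj : j + 1 ≤ P.m + P.K) (x : Balaban1983to89.Site P j) (κ : Fin P.d) :
    corner (blockOf x) κ + (inBlock x κ : ZMod (P.sitesPerDir j)) = x κ := by
  conv_rhs => rw [← blockSite_offs hj x]
  simp only [corner, Balaban1983to89.Site.blockSite, coe_offs]
  push_cast
  ring

/-! ## §2 (2.4)–(2.5): the standard contours `Γ_{yx}` and the transports `u(Γ_{yx})` -/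

/-- The sites of the leg of `Γ_{yx}` in direction `μ` (`y` = the corner of the block of `x`): coordinates of the corner in the directions
`κ < μ` (legs still to come), `corner + t` in direction `μ` (`t = 0, …, n_μ`), coordinates of `x` in the directions `κ > μ` (legs done) —
the contour leaves the corner along the highest axis first, which is (2.4)'s *"following the coordinate axis one, then axis two, …, in
going from x to y"* read from `y` to `x`. [cite: BalabanImbrieJaffe1985, (2.4) p.302] -/
def legSite (x : Balaban1983to89.Site P j) (μ : Fin P.d) (t : ℕ) : Balaban1983to89.Site P j := fun κ =>
  if κ < μ then corner (blockOf x) κ else if κ = μ then corner (blockOf x) μ + t else x κ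

/-- The `t`-th bond of the leg of `Γ_{yx}` in direction `μ`: `⟨legSite x μ t, legSite x μ t + e_μ⟩`, `t < n_μ`.
[cite: BalabanImbrieJaffe1985, (2.4) p.302] -/
def legBond (x : Balaban1983to89.Site P j) (μ : Fin P.d) (t : ℕ) : PBond P j := ⟨legSite x μ t, μ⟩

/-- kernel: the legs are CONSECUTIVE — the end-point of the `t`-th bond is the source of the `(t+1)`-st. [cite: BalabanImbrieJaffe1985, (2.5) p.302] -/
theorem legSite_shift (x : Balaban1983to89.Site P j) (μ : Fin P.d) (t : ℕ) : (legSite x μ t).shift μ = legSite x μ (t + 1) := by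
  funext κ
  by_cases hκ : κ = μ
  · subst hκ
    simp only [Balaban1983to89.Site.shift, Function.update_self, legSite, lt_irrefl, if_false, if_true]
    push_cast
    ring
  · simp only [Balaban1983to89.Site.shift, Function.update_of_ne hκ, legSite, if_neg hκ]

/-- kernel: the end-point of a leg bond. [cite: BalabanImbrieJaffe1985, (2.5) p.302] -/
theorem legBond_tgt (x : Balaban1983to89.Site P j) (μ : Fin P.d) (t : ℕ) : (legBond x μ t).tgt = legSite x μ (t + 1) :=
  legSite_shift x μ t

/-- The junction sites of `Γ_{yx}`: corner coordinates in the directions `< i`, coordinates of `x` in the directions `≥ i`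
(`i = d`: the corner `y`; `i = 0`: the site `x`). [cite: BalabanImbrieJaffe1985, (2.4) p.302] -/
def junction (x : Balaban1983to89.Site P j) (i : ℕ) : Balaban1983to89.Site P j := fun κ => if (κ : ℕ) < i then corner (blockOf x) κ else x κ

/-- kernel: `Γ_{yx}` ends at `x`. [cite: BalabanImbrieJaffe1985, (2.4) p.302] -/
theorem junction_zero (x : Balaban1983to89.Site P j) : junction x 0 = x := by
  funext κ; simp [junction]

/-- kernel: `Γ_{yx}` starts at the corner `y`. [cite: BalabanImbrieJaffe1985, (2.4) p.302] -/
theorem junction_d (x : Balaban1983to89.Site P j) : junction x P.d = corner (blockOf x) := by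
  funext κ; simp [junction, κ.isLt]

/-- kernel: the leg in direction `μ` starts at the junction `μ + 1`. [cite: BalabanImbrieJaffe1985, (2.4) p.302] -/
theorem legSite_zero (x : Balaban1983to89.Site P j) (μ : Fin P.d) : legSite x μ 0 = junction x (μ + 1) := by
  funext κ
  simp only [legSite, junction, Nat.cast_zero, add_zero]
  by_cases h1 : κ < μ
  · rw [if_pos h1, if_pos (by have := Fin.lt_def.1 h1; omega)]
  · by_cases h2 : κ = μ
    · subst h2; rw [if_neg h1, if_pos rfl, if_pos (Nat.lt_succ_self _)]
    · rw [if_neg h1, if_neg h2, if_neg]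
      intro h
      rcases Nat.lt_succ_iff_lt_or_eq.1 h with h' | h'
      · exact h1 (Fin.lt_def.2 h')
      · exact h2 (Fin.ext h')

/-- kernel: … and ends, after `n_μ = offs x μ` bonds, at the junction `μ` (standing range). [cite: BalabanImbrieJaffe1985, (2.4) p.302] -/
theorem legSite_inBlock (hj : j + 1 ≤ P.m + P.K) (x : Balaban1983to89.Site P j) (μ : Fin P.d) : legSite x μ (inBlock x μ) = junction x μ := by
  funext κ
  simp only [legSite, junction]
  by_cases h1 : κ < μ
  · rw [if_pos h1, if_pos (Fin.lt_def.1 h1)]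
  · by_cases h2 : κ = μ
    · subst h2; rw [if_neg h1, if_pos rfl, if_neg (lt_irrefl _), corner_add_inBlock hj]
    · rw [if_neg h1, if_neg h2, if_neg (fun h => h1 (Fin.lt_def.2 h))]

/-- The offsets of the sites of the leg in direction `μ` (for `t < L`). [cite: BalabanImbrieJaffe1985, (2.4) p.302] -/
def legOffs (x : Balaban1983to89.Site P j) (μ : Fin P.d) (t : Fin P.L) : Fin P.d → Fin P.L := fun κ =>
  if κ < μ then ⟨0, P.L_pos⟩ else if κ = μ then t else offs x κ

/-- kernel: the leg sites lie in the block of `x`, with offsets `legOffs` (standing range). [cite: BalabanImbrieJaffe1985, (2.4) p.302] -/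
theorem legSite_eq_blockSite (hj : j + 1 ≤ P.m + P.K) (x : Balaban1983to89.Site P j) (μ : Fin P.d) (t : Fin P.L) :
    legSite x μ t = Balaban1983to89.Site.blockSite (blockOf x) (legOffs x μ t) := by
  funext κ
  by_cases h1 : κ < μ
  · simp only [legSite, if_pos h1, corner, Balaban1983to89.Site.blockSite, legOffs]
  · by_cases h2 : κ = μ
    · subst h2
      simp only [legSite, legOffs, if_neg h1, if_true, corner, Balaban1983to89.Site.blockSite]
      push_cast
      ring
    · simp only [legSite, if_neg h1, if_neg h2, Balaban1983to89.Site.blockSite, legOffs, coe_offs]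
      have e := congrFun (blockSite_offs hj x) κ
      simp only [Balaban1983to89.Site.blockSite, coe_offs] at e
      exact e.symm

/-- kernel: the legs stay in the block of `x`. [cite: BalabanImbrieJaffe1985, (2.4) p.302] -/
theorem blockOf_legSite (hj : j + 1 ≤ P.m + P.K) (x : Balaban1983to89.Site P j) (μ : Fin P.d) (t : Fin P.L) :
    blockOf (legSite x μ t) = blockOf x := by
  rw [legSite_eq_blockSite hj, Balaban1983to89.Site.blockOf_blockSite hj]

/-- kernel: in-block positions along a leg. [cite: BalabanImbrieJaffe1985, (2.4) p.302] -/
theorem inBlock_legSite (hj : j + 1 ≤ P.m + P.K) (x : Balaban1983to89.Site P j) (μ : Fin P.d) (t : Fin P.L) (κ : Fin P.d) :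
    inBlock (legSite x μ t) κ = legOffs x μ t κ := by
  rw [legSite_eq_blockSite hj, inBlock_blockSite hj]

/-- **Every bond of `Γ_{yx}` is a tree bond of the axial gauge (3.4)** (`BIJ88RenormTransf311.IsAxialBond`: corner positions in the
directions `κ < μ`, and the bond does not leave the block) — the typed content of *"T(y) denote the tree composed of unit bonds in Γ_{yx}"*.
[cite: BalabanImbrieJaffe1985, (3.4) p.306] -/
theorem isAxialBond_legBond (hj : j + 1 ≤ P.m + P.K) {x : Balaban1983to89.Site P j} {μ : Fin P.d} {t : ℕ} (ht : t < inBlock x μ) :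
    IsAxialBond (legBond x μ t) := by
  have hL : inBlock x μ < P.L := Nat.mod_lt _ P.L_pos
  have htL : t < P.L := lt_trans ht hL
  have key : ∀ κ, inBlock (legSite x μ t) κ = legOffs x μ ⟨t, htL⟩ κ := fun κ => inBlock_legSite hj x μ ⟨t, htL⟩ κ
  refine ⟨fun κ (hκ : κ < μ) => ?_, ?_⟩
  · show inBlock (legSite x μ t) κ = 0
    rw [key]
    simp [legOffs, hκ]
  · show inBlock (legSite x μ t) μ + 1 < P.L
    rw [key]
    simp only [legOffs, lt_irrefl, if_false, if_true]
    omega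

/-- kernel: the bonds of `Γ_{yx}` belong to r18's `axialBonds`. [cite: BalabanImbrieJaffe1985, (3.4) p.306] -/
theorem legBond_mem_axialBonds (hj : j + 1 ≤ P.m + P.K) {x : Balaban1983to89.Site P j} {μ : Fin P.d} {t : ℕ} (ht : t < inBlock x μ) :
    legBond x μ t ∈ (axialBonds : Finset (PBond P j)) :=
  mem_axialBonds.2 (isAxialBond_legBond hj ht)

/-- **(2.5) along one leg**: `Π_{t < n_μ} u(legBond x μ t) ∈ ℂ`. [cite: BalabanImbrieJaffe1985, (2.5) p.302] -/
def legProd (U : GaugeField P j U1) (x : Balaban1983to89.Site P j) (μ : Fin P.d) : ℂ :=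
  ∏ t ∈ range (inBlock x μ), toC (U (legBond x μ t))

/-- **(2.5) `u(Γ_{yx}) = Π_{b∈Γ_{yx}} u_b`** for the standard contour from the corner of the block of `x` to `x` (abelian: the product
over the legs). [cite: BalabanImbrieJaffe1985, (2.5) p.302] -/
def holC (U : GaugeField P j U1) (x : Balaban1983to89.Site P j) : ℂ := ∏ μ : Fin P.d, legProd U x μ

/-- kernel: `u(Γ_{yx}) ≠ 0`. [cite: BalabanImbrieJaffe1985, (2.5) p.302] -/
theorem legProd_ne_zero (U : GaugeField P j U1) (x : Balaban1983to89.Site P j) (μ : Fin P.d) : legProd U x μ ≠ 0 :=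
  prod_ne_zero_iff.2 fun _ _ => toC_ne_zero _

/-- kernel: `u(Γ_{yx}) ≠ 0`. [cite: BalabanImbrieJaffe1985, (2.5) p.302] -/
theorem holC_ne_zero (U : GaugeField P j U1) (x : Balaban1983to89.Site P j) : holC U x ≠ 0 :=
  prod_ne_zero_iff.2 fun μ _ => legProd_ne_zero U x μ

/-- **In the axial gauge `u(Γ_{yx}) = 1`** (p. 303: *"In axial gauge we choose h in order to set u_b = 1 for every b which occurs in some
Γ_{yx}"*; here: `u_b = 1` on r18's `axialBonds` ⟹ every leg product is `1`). [cite: BalabanImbrieJaffe1985, (2.6) p.303] -/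
theorem holC_of_deltaAx (hj : j + 1 ≤ P.m + P.K) {U : GaugeField P j U1} (hU : DeltaAx U) (x : Balaban1983to89.Site P j) : holC U x = 1 := by
  refine prod_eq_one fun μ _ => prod_eq_one fun t ht => ?_
  rw [hU _ (legBond_mem_axialBonds hj (mem_range.1 ht)), toC_one]

/-- kernel: the telescoping of (2.7) along one leg. [cite: BalabanImbrieJaffe1985, (2.8) p.303] -/
theorem legProd_gaugeAct (h : GaugeTransf P j U1) (U : GaugeField P j U1) (x : Balaban1983to89.Site P j) (μ : Fin P.d) :
    legProd (gaugeAct h U) x μ =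
      toC (h (legSite x μ 0)) * legProd U x μ * (toC (h (legSite x μ (inBlock x μ))))⁻¹ := by
  unfold legProd
  have e : ∀ t ∈ range (inBlock x μ), toC (gaugeAct h U (legBond x μ t)) =
      toC (h (legSite x μ t)) * toC (U (legBond x μ t)) * (toC (h (legSite x μ (t + 1))))⁻¹ := by
    intro t _
    rw [toC_gaugeAct, legBond_tgt]
    rfl
  rw [prod_congr rfl e]
  exact prod_range_telescope (fun t => toC (h (legSite x μ t))) (fun t => toC_ne_zero _) _ _

/-- **(2.7) telescopes along `Γ_{yx}`: `u^h(Γ_{yx}) = h(y)u(Γ_{yx})h(x)^{−1}`**, `y` = the corner of the block of `x` (standing range).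
[cite: BalabanImbrieJaffe1985, (2.8) p.303] -/
theorem holC_gaugeAct (hj : j + 1 ≤ P.m + P.K) (h : GaugeTransf P j U1) (U : GaugeField P j U1) (x : Balaban1983to89.Site P j) :
    holC (gaugeAct h U) x = toC (h (corner (blockOf x))) * holC U x * (toC (h x))⁻¹ := by
  unfold holC
  set f : ℕ → ℂ := fun i => toC (h (junction x i)) with hf
  have hf0 : ∀ i, f i ≠ 0 := fun i => toC_ne_zero _
  have e : ∀ μ : Fin P.d, legProd (gaugeAct h U) x μ = f (μ + 1) * legProd U x μ * (f μ)⁻¹ := by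
    intro μ
    rw [legProd_gaugeAct, legSite_zero, legSite_inBlock hj]
  simp_rw [e]
  rw [prod_mul_distrib, prod_mul_distrib, Fin.prod_univ_eq_prod_range (fun i => f (i + 1)) P.d,
    Fin.prod_univ_eq_prod_range (fun i => (f i)⁻¹) P.d]
  have key := prod_succ_mul_prod_inv f hf0 P.d
  have hfd : f P.d = toC (h (corner (blockOf x))) := by simp only [hf, junction_d]
  have hf0' : f 0 = toC (h x) := by simp only [hf, junction_zero]
  calc (∏ i ∈ range P.d, f (i + 1)) * (∏ μ : Fin P.d, legProd U x μ) * ∏ i ∈ range P.d, (f i)⁻¹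
      = ((∏ i ∈ range P.d, f (i + 1)) * ∏ i ∈ range P.d, (f i)⁻¹) * ∏ μ : Fin P.d, legProd U x μ := by ring
    _ = f P.d * (f 0)⁻¹ * ∏ μ : Fin P.d, legProd U x μ := by rw [key]
    _ = _ := by rw [hfd, hf0']; ring

/-! ## §3 (2.6): the covariant scalar average `Q(u)φ`, (2.8), and the axial-gauge reduction -/

/-- **(2.6)** *"(Qφ)_y = L^{−d} Σ_{x∈B(y)} u(Γ_{yx})φ_x"* — the covariant block average of the scalar field on the torus of record (the
`ℤ^d` decl of record is p03's `BIJ85AxialGauge35.qCov`; the abstract cell shape is r15's `BIJ85CellAverages.Cells.Qcov`).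
[cite: BalabanImbrieJaffe1985, (2.6) p.303] -/
def qCov (U : GaugeField P j U1) (φ : HiggsField P j) : HiggsField P (j+1) := fun y =>
  ((P.L : ℂ) ^ P.d)⁻¹ * ∑ x ∈ block y, holC U x * φ x

/-- kernel: the value of (2.6) at a coarse site. [cite: BalabanImbrieJaffe1985, (2.6) p.303] -/
theorem qCov_apply (U : GaugeField P j U1) (φ : HiggsField P j) (y : Balaban1983to89.Site P (j+1)) :
    qCov U φ y = ((P.L : ℂ) ^ P.d)⁻¹ * ∑ x ∈ block y, holC U x * φ x := rfl

/-- **(2.8)** *"Clearly (Qφ)^h = Qφ^h"*: `Q(u^h)φ^h = (Q(u)φ)^h`, the transformed average being multiplied by `h` at the block corner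
`y` (the coarse site of (2.6)) — PROVED from the telescoping `holC_gaugeAct` (standing range). [cite: BalabanImbrieJaffe1985, (2.8) p.303] -/
theorem qCov_gaugeAct (hj : j + 1 ≤ P.m + P.K) (h : GaugeTransf P j U1) (U : GaugeField P j U1) (φ : HiggsField P j)
    (y : Balaban1983to89.Site P (j+1)) :
    qCov (gaugeAct h U) (fun x => toC (h x) * φ x) y = toC (h (corner y)) * qCov U φ y := by
  simp only [qCov_apply, Finset.mul_sum]
  refine sum_congr rfl fun x hx => ?_
  rw [holC_gaugeAct hj, mem_block_iff.1 hx,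
    show ((P.L : ℂ) ^ P.d)⁻¹ * (toC (h (corner y)) * holC U x * (toC (h x))⁻¹ * (toC (h x) * φ x))
      = toC (h (corner y)) * (((P.L : ℂ) ^ P.d)⁻¹ * (holC U x * φ x)) * ((toC (h x))⁻¹ * toC (h x)) by ring,
    inv_mul_cancel₀ (toC_ne_zero (h x)), mul_one]

/-- **(2.8) for C1's scalar gauge action `BIJ85RT33.twist`**: `Q(u^h)(hφ) = h(y)·Q(u)φ`. [cite: BalabanImbrieJaffe1985, (2.8) p.303] -/
theorem qCov_gaugeAct_twist (hj : j + 1 ≤ P.m + P.K) (h : GaugeTransf P j U1) (U : GaugeField P j U1) (φ : HiggsField P j)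
    (y : Balaban1983to89.Site P (j+1)) :
    qCov (gaugeAct h U) (BIJ85RT33.twist h φ) y = toC (h (corner y)) * qCov U φ y :=
  qCov_gaugeAct hj h U φ y

/-- p. 303: *"In the axial gauge, Qφ reduces to the ordinary average of φ"* — PROVED: `u_b = 1` on the tree bonds (r18's `DeltaAx`) gives
`(Q(u)φ)_y = L^{−d} Σ_{x∈B(y)} φ_x`. [cite: BalabanImbrieJaffe1985, (2.6) p.303] -/
theorem qCov_of_deltaAx (hj : j + 1 ≤ P.m + P.K) {U : GaugeField P j U1} (hU : DeltaAx U) (φ : HiggsField P j)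
    (y : Balaban1983to89.Site P (j+1)) : qCov U φ y = ((P.L : ℂ) ^ P.d)⁻¹ * ∑ x ∈ block y, φ x := by
  rw [qCov_apply]
  congr 1
  exact sum_congr rfl fun x _ => by rw [holC_of_deltaAx hj hU, one_mul]

/-! ## §4 (2.10)–(2.11): the straight runs, the closed contours, and the gauge-field average `Qu` -/

/-- The sites `x + te_μ` of the straight run from `x` in direction `μ` (`Γ_{xx′}`, *"translates of Γ_{yy′}"*; for `x` a corner and
`t ≤ L` this is the `L`-lattice bond `Γ_{yy′}` read as a path of unit bonds). [cite: BalabanImbrieJaffe1985, (2.10) p.303] -/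
def runSite (x : Balaban1983to89.Site P j) (μ : Fin P.d) (t : ℕ) : Balaban1983to89.Site P j := Function.update x μ (x μ + t)

/-- The `t`-th unit bond `⟨x + te_μ, x + (t+1)e_μ⟩` of the straight run. [cite: BalabanImbrieJaffe1985, (2.10) p.303] -/
def runBond (x : Balaban1983to89.Site P j) (μ : Fin P.d) (t : ℕ) : PBond P j := ⟨runSite x μ t, μ⟩

/-- kernel: the run starts at `x`. [cite: BalabanImbrieJaffe1985, (2.10) p.303] -/
@[simp] theorem runSite_zero (x : Balaban1983to89.Site P j) (μ : Fin P.d) : runSite x μ 0 = x := by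
  simp [runSite]

/-- kernel: the run bonds are consecutive. [cite: BalabanImbrieJaffe1985, (2.10) p.303] -/
theorem runSite_shift (x : Balaban1983to89.Site P j) (μ : Fin P.d) (t : ℕ) : (runSite x μ t).shift μ = runSite x μ (t + 1) := by
  funext κ
  by_cases hκ : κ = μ
  · subst hκ
    simp only [Balaban1983to89.Site.shift, runSite, Function.update_self]
    push_cast
    ring
  · simp only [Balaban1983to89.Site.shift, runSite, Function.update_of_ne hκ]

/-- kernel: the end-point of a run bond. [cite: BalabanImbrieJaffe1985, (2.10) p.303] -/
theorem runBond_tgt (x : Balaban1983to89.Site P j) (μ : Fin P.d) (t : ℕ) : (runBond x μ t).tgt = runSite x μ (t + 1) :=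
  runSite_shift x μ t

/-- **`u(Γ_{xx′}) = Π_{t<L} u(⟨x + te_μ, x + (t+1)e_μ⟩)`**, the transport along the straight run of `L` unit bonds (`x′ = x + Le_μ`); for
`x = y` a corner this is `u(Γ_{yy′})`, `Γ_{yy′} = b′` the `L`-lattice bond. (The `ℤ^d` decl of record is p03's `BIJ85AxialGauge35.run`.)
[cite: BalabanImbrieJaffe1985, (2.10) p.303] -/
def runC (U : GaugeField P j U1) (x : Balaban1983to89.Site P j) (μ : Fin P.d) : ℂ :=
  ∏ t ∈ range P.L, toC (U (runBond x μ t))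

/-- kernel: `u(Γ_{xx′}) ≠ 0`. [cite: BalabanImbrieJaffe1985, (2.10) p.303] -/
theorem runC_ne_zero (U : GaugeField P j U1) (x : Balaban1983to89.Site P j) (μ : Fin P.d) : runC U x μ ≠ 0 :=
  prod_ne_zero_iff.2 fun _ _ => toC_ne_zero _

/-- The total phase of a run in the branch (2.11): `Σ_{t<L} argB u(b_t)`, so that `u(Γ_{xx′}) = exp(i·runArg)` (`exp_runArg_mul_I`).
[cite: BalabanImbrieJaffe1985, (2.11) p.303] -/
def runArg (U : GaugeField P j U1) (x : Balaban1983to89.Site P j) (μ : Fin P.d) : ℝ :=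
  ∑ t ∈ range P.L, argB (toC (U (runBond x μ t)))

/-- kernel: `exp(i Σ_t argB u(b_t)) = u(Γ_{xx′})`. [cite: BalabanImbrieJaffe1985, (2.11) p.303] -/
theorem exp_runArg_mul_I (U : GaugeField P j U1) (x : Balaban1983to89.Site P j) (μ : Fin P.d) :
    Complex.exp ((runArg U x μ : ℂ) * I) = runC U x μ := by
  rw [runArg, runC, ofReal_sum, sum_mul, Complex.exp_sum]
  exact prod_congr rfl fun t _ => exp_argB_toC _

/-- kernel: (2.7) telescopes along a straight run: `u^h(Γ_{xx′}) = h(x)u(Γ_{xx′})h(x′)^{−1}`. [cite: BalabanImbrieJaffe1985, (2.10) p.303] -/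
theorem runC_gaugeAct (h : GaugeTransf P j U1) (U : GaugeField P j U1) (x : Balaban1983to89.Site P j) (μ : Fin P.d) :
    runC (gaugeAct h U) x μ = toC (h x) * runC U x μ * (toC (h (runSite x μ P.L)))⁻¹ := by
  unfold runC
  have e : ∀ t ∈ range P.L, toC (gaugeAct h U (runBond x μ t)) =
      toC (h (runSite x μ t)) * toC (U (runBond x μ t)) * (toC (h (runSite x μ (t + 1))))⁻¹ := by
    intro t _
    rw [toC_gaugeAct, runBond_tgt]
    rfl
  rw [prod_congr rfl e, prod_range_telescope (fun t => toC (h (runSite x μ t))) (fun t => toC_ne_zero _), runSite_zero]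

/-- **The closed contour of (2.10)**: `u(Γ_{yx} ∘ Γ_{xx′} ∘ Γ_{y′x′}^{−1} ∘ Γ_{y′y}) = u(Γ_{yx})u(Γ_{xx′})u(Γ_{y′x′})^{−1}u(Γ_{yy′})^{−1}` for the
`L`-lattice bond `c = ⟨y, y′ = y + e_μ⟩` and `x ∈ B(y)`, `x′ = x + Le_μ ∈ B(y′)` (abelian: a product; reversed paths = inverses, (2.5)). (The
`ℤ^d` decl of record is p03's `BIJ85AxialGauge35.loop210`.) [cite: BalabanImbrieJaffe1985, (2.10) p.303] -/
def loopC (U : GaugeField P j U1) (c : PBond P (j+1)) (x : Balaban1983to89.Site P j) : ℂ :=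
  holC U x * runC U x c.dir * (holC U (runSite x c.dir P.L))⁻¹ * (runC U (corner c.src) c.dir)⁻¹

/-- kernel: the loop variable is non-zero. [cite: BalabanImbrieJaffe1985, (2.10) p.303] -/
theorem loopC_ne_zero (U : GaugeField P j U1) (c : PBond P (j+1)) (x : Balaban1983to89.Site P j) : loopC U c x ≠ 0 :=
  mul_ne_zero (mul_ne_zero (mul_ne_zero (holC_ne_zero _ _) (runC_ne_zero _ _ _)) (inv_ne_zero (holC_ne_zero _ _)))
    (inv_ne_zero (runC_ne_zero _ _ _))

/-- **The exponent of (2.10) with the branch (2.11)**: `L^{−d} Σ_{x∈B(y)} (1/i) ln u(loop_x)`, `(1/i) ln = argB ∈ [−π, π)`.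
[cite: BalabanImbrieJaffe1985, (2.11) p.303] -/
def loopAvg (U : GaugeField P j U1) (c : PBond P (j+1)) : ℝ :=
  ((P.L : ℝ) ^ P.d)⁻¹ * ∑ x ∈ block c.src, argB (loopC U c x)

/-- **(2.10)** *"(Qu)_{yy′} = u(Γ_{yy′}) exp[L^{−d} Σ_{x∈B(y)} ln u(Γ_{yx} ∘ Γ_{xx′} ∘ Γ_{y′x′}^{−1} ∘ Γ_{y′y})]"* with the logarithm of
**(2.11)** — the block average of the `U(1)` gauge field ON THE TORUS OF RECORD, a map `GaugeField P j U1 → GaugeField P (j+1) U1`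
(the `L`-lattice bond `c = ⟨y, y + e_μ⟩`; `u(Γ_{yy′}) = exp(i Σ_t argB u_{b_t})` so that the whole of (2.10) is one element `e^{iθ}` of
`U(1)`, see `toC_qU`).  The `ℤ^d` decl of record is p03's `BIJ85AxialGauge35.qU`. [cite: BalabanImbrieJaffe1985, (2.10) p.303] -/
def qU (U : GaugeField P j U1) : GaugeField P (j+1) U1 := fun c =>
  expU1 (runArg U (corner c.src) c.dir + loopAvg U c)

/-- **(2.10) read in `ℂ`**: `toC (Qu)_{yy′} = u(Γ_{yy′}) · exp(i L^{−d} Σ_{x∈B(y)} argB u(loop_x))`. [cite: BalabanImbrieJaffe1985, (2.10) p.303] -/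
theorem toC_qU (U : GaugeField P j U1) (c : PBond P (j+1)) :
    toC (qU U c) = runC U (corner c.src) c.dir * Complex.exp ((loopAvg U c : ℂ) * I) := by
  show toC (expU1 _) = _
  rw [toC_expU1, ofReal_add, add_mul, Complex.exp_add, exp_runArg_mul_I]

/-! ### The runs in block coordinates: which block, which position (standing range) -/

/-- kernel: the first part of the run from `x` (while `offs x μ + t < L`) stays in the block of `x`, at position `offs x μ + t`.
[cite: BalabanImbrieJaffe1985, (2.10) p.303] -/
theorem runSite_eq_blockSite_lo (hj : j + 1 ≤ P.m + P.K) (x : Balaban1983to89.Site P j) (μ : Fin P.d) {t : ℕ} (ht : inBlock x μ + t < P.L) :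
    runSite x μ t = Balaban1983to89.Site.blockSite (blockOf x) (Function.update (offs x) μ ⟨inBlock x μ + t, ht⟩) := by
  funext κ
  by_cases hκ : κ = μ
  · subst hκ
    rw [runSite, Function.update_self, ← corner_add_inBlock hj x κ]
    simp only [Balaban1983to89.Site.blockSite, Function.update_self, corner]
    push_cast
    ring
  · rw [runSite, Function.update_of_ne hκ]
    conv_lhs => rw [← blockSite_offs hj x]
    simp only [Balaban1983to89.Site.blockSite, Function.update_of_ne hκ]

/-- kernel: the second part of the run (`L ≤ offs x μ + t`, `t ≤ L`) lies in the NEXT block `blockOf x + e_μ`, at position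
`offs x μ + t − L` (standing range; the torus wrap-around of the coarse label is `AveragingRT.cast_succ_mul_L`).
[cite: BalabanImbrieJaffe1985, (2.10) p.303] -/
theorem runSite_eq_blockSite_hi (hj : j + 1 ≤ P.m + P.K) (x : Balaban1983to89.Site P j) (μ : Fin P.d) {t : ℕ} (ht1 : P.L ≤ inBlock x μ + t)
    (ht2 : t ≤ P.L) :
    runSite x μ t = Balaban1983to89.Site.blockSite ((blockOf x).shift μ)
      (Function.update (offs x) μ ⟨inBlock x μ + t - P.L, by have := Nat.mod_lt (x μ).val P.L_pos; unfold inBlock; omega⟩) := by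
  funext κ
  by_cases hκ : κ = μ
  · subst hκ
    rw [runSite, Function.update_self]
    conv_lhs => rw [← corner_add_inBlock hj x κ]
    simp only [Balaban1983to89.Site.blockSite, Function.update_self, corner, Balaban1983to89.Site.shift, Fin.val_mk]
    rw [AveragingRT.cast_succ_mul_L hj]
    have e : (blockOf x κ).val * P.L + P.L + (inBlock x κ + t - P.L) = (blockOf x κ).val * P.L + 0 + (inBlock x κ + t) := by omega
    rw [e]
    push_cast
    ring
  · rw [runSite, Function.update_of_ne hκ]
    conv_lhs => rw [← blockSite_offs hj x]
    simp only [Balaban1983to89.Site.blockSite, Function.update_of_ne hκ, Balaban1983to89.Site.shift]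

/-- kernel: the end `x′ = x + Le_μ` of the run lies in the next block with the SAME offsets (it is the translate of `x`).
[cite: BalabanImbrieJaffe1985, (2.10) p.303] -/
theorem runSite_L (hj : j + 1 ≤ P.m + P.K) (x : Balaban1983to89.Site P j) (μ : Fin P.d) :
    runSite x μ P.L = Balaban1983to89.Site.blockSite ((blockOf x).shift μ) (offs x) := by
  rw [runSite_eq_blockSite_hi hj x μ (t := P.L) (by omega) le_rfl]
  congr 1
  funext κ
  by_cases hκ : κ = μ
  · subst hκ; rw [Function.update_self]; apply Fin.ext; simp
  · rw [Function.update_of_ne hκ]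

/-- kernel: `blockOf (x + Le_μ) = blockOf x + e_μ`. [cite: BalabanImbrieJaffe1985, (2.10) p.303] -/
theorem blockOf_runSite_L (hj : j + 1 ≤ P.m + P.K) (x : Balaban1983to89.Site P j) (μ : Fin P.d) :
    blockOf (runSite x μ P.L) = (blockOf x).shift μ := by
  rw [runSite_L hj, Balaban1983to89.Site.blockOf_blockSite hj]

/-- kernel: `x + Le_μ` has the offsets of `x`. [cite: BalabanImbrieJaffe1985, (2.10) p.303] -/
theorem inBlock_runSite_L (hj : j + 1 ≤ P.m + P.K) (x : Balaban1983to89.Site P j) (μ : Fin P.d) (κ : Fin P.d) :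
    inBlock (runSite x μ P.L) κ = inBlock x κ := by
  rw [runSite_L hj, inBlock_blockSite hj, coe_offs]

/-- kernel: **the corner of the adjacent block is the end of the `L`-lattice bond**: `corner (y + e_μ) = corner y + Le_μ` (so `Γ_{yy′}` IS
the run of `L` unit bonds from the corner). [cite: BalabanImbrieJaffe1985, (2.10) p.303] -/
theorem corner_shift (hj : j + 1 ≤ P.m + P.K) (y : Balaban1983to89.Site P (j+1)) (μ : Fin P.d) :
    corner (y.shift μ) = runSite (corner y) μ P.L := by
  rw [runSite_L hj, blockOf_corner hj]
  unfold corner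
  congr 1
  funext κ
  apply Fin.ext
  rw [coe_offs]
  exact (inBlock_corner hj y κ).symm

/-- kernel: the block of a site in the first part of a run. [cite: BalabanImbrieJaffe1985, (2.10) p.303] -/
theorem blockOf_runSite_lo (hj : j + 1 ≤ P.m + P.K) (x : Balaban1983to89.Site P j) (μ : Fin P.d) {t : ℕ} (ht : inBlock x μ + t < P.L) :
    blockOf (runSite x μ t) = blockOf x := by
  rw [runSite_eq_blockSite_lo hj x μ ht, Balaban1983to89.Site.blockOf_blockSite hj]

/-- kernel: the in-block position (direction `μ`) of a site in the first part of a run. [cite: BalabanImbrieJaffe1985, (2.10) p.303] -/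
theorem inBlock_runSite_lo (hj : j + 1 ≤ P.m + P.K) (x : Balaban1983to89.Site P j) (μ : Fin P.d) {t : ℕ} (ht : inBlock x μ + t < P.L) :
    inBlock (runSite x μ t) μ = inBlock x μ + t := by
  rw [runSite_eq_blockSite_lo hj x μ ht, inBlock_blockSite hj, Function.update_self]

/-- kernel: the in-block position (direction `μ`) of a site in the second part of a run. [cite: BalabanImbrieJaffe1985, (2.10) p.303] -/
theorem inBlock_runSite_hi (hj : j + 1 ≤ P.m + P.K) (x : Balaban1983to89.Site P j) (μ : Fin P.d) {t : ℕ} (ht1 : P.L ≤ inBlock x μ + t)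
    (ht2 : t ≤ P.L) : inBlock (runSite x μ t) μ = inBlock x μ + t - P.L := by
  rw [runSite_eq_blockSite_hi hj x μ ht1 ht2, inBlock_blockSite hj, Function.update_self]

/-! ### The loop of (2.10) is gauge invariant; `Q` commutes with gauge transformations on gauge fields -/

/-- **The closed contour of (2.10) is gauge INVARIANT** under (2.7) (a closed loop based at the corner `y`; abelian group) — for `x ∈ B(y)`
(standing range). [cite: BalabanImbrieJaffe1985, (2.10) p.303] -/
theorem loopC_gaugeAct (hj : j + 1 ≤ P.m + P.K) (h : GaugeTransf P j U1) (U : GaugeField P j U1) (c : PBond P (j+1))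
    {x : Balaban1983to89.Site P j} (hx : x ∈ block c.src) : loopC (gaugeAct h U) c x = loopC U c x := by
  have hy : blockOf x = c.src := mem_block_iff.1 hx
  unfold loopC
  rw [holC_gaugeAct hj, holC_gaugeAct hj, runC_gaugeAct, runC_gaugeAct, blockOf_runSite_L hj, hy, ← corner_shift hj]
  have h1 := toC_ne_zero (h (corner c.src))
  have h2 := toC_ne_zero (h x)
  have h3 := toC_ne_zero (h (corner (c.src.shift c.dir)))
  have h4 := toC_ne_zero (h (runSite x c.dir P.L))
  have h5 := holC_ne_zero U x
  have h6 := holC_ne_zero U (runSite x c.dir P.L)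
  have h7 := runC_ne_zero U x c.dir
  have h8 := runC_ne_zero U (corner c.src) c.dir
  field_simp

/-- kernel: hence the exponent of (2.10) is gauge invariant. [cite: BalabanImbrieJaffe1985, (2.10) p.303] -/
theorem loopAvg_gaugeAct (hj : j + 1 ≤ P.m + P.K) (h : GaugeTransf P j U1) (U : GaugeField P j U1) (c : PBond P (j+1)) :
    loopAvg (gaugeAct h U) c = loopAvg U c := by
  unfold loopAvg
  congr 1
  exact sum_congr rfl fun x hx => by rw [loopC_gaugeAct hj h U c hx]

/-- **`Q` commutes with gauge transformations on gauge fields**: `Q(u^h) = (Qu)^{h′}` with the `L`-lattice gauge transformation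
`h′(y) = h(corner of B(y))` acting by (2.7) on the `L`-lattice (`(Qu)^{h′}_{yy′} = h(y)(Qu)_{yy′}h(y′)^{−1}`) — the loop is invariant and
`u(Γ_{yy′})` telescopes between the two corners (standing range).  (The `ℤ^d` decl of record is p03's `BIJ85AxialGauge35.qU_gaugeAct`.)
[cite: BalabanImbrieJaffe1985, (2.10) p.303] -/
theorem qU_gaugeAct (hj : j + 1 ≤ P.m + P.K) (h : GaugeTransf P j U1) (U : GaugeField P j U1) :
    qU (gaugeAct h U) = gaugeAct (fun y => h (corner y)) (qU U) := by
  funext c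
  apply toC_injective_U1
  rw [toC_gaugeAct, toC_qU, toC_qU, loopAvg_gaugeAct hj, runC_gaugeAct, ← corner_shift hj]
  simp only [PBond.tgt]
  ring

/-! ### Measurability of (2.6) and (2.10) -/

/-- kernel: a bond variable read in `ℂ` is a measurable function of the field. [cite: BalabanImbrieJaffe1985, (2.5) p.302] -/
theorem measurable_toC_apply (b : PBond P j) : Measurable fun U : GaugeField P j U1 => toC (U b) :=
  measurable_toC.comp (measurable_pi_apply b)

/-- kernel: `u(Γ_{yx})` is a measurable function of the field. [cite: BalabanImbrieJaffe1985, (2.5) p.302] -/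
theorem measurable_holC (x : Balaban1983to89.Site P j) : Measurable fun U : GaugeField P j U1 => holC U x := by
  unfold holC legProd
  exact Finset.measurable_prod _ fun μ _ => Finset.measurable_prod _ fun t _ => measurable_toC_apply _

/-- kernel: `u(Γ_{xx′})` is a measurable function of the field. [cite: BalabanImbrieJaffe1985, (2.10) p.303] -/
theorem measurable_runC (x : Balaban1983to89.Site P j) (μ : Fin P.d) : Measurable fun U : GaugeField P j U1 => runC U x μ := by
  unfold runC
  exact Finset.measurable_prod _ fun t _ => measurable_toC_apply _

/-- kernel: the run phase is measurable. [cite: BalabanImbrieJaffe1985, (2.11) p.303] -/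
theorem measurable_runArg (x : Balaban1983to89.Site P j) (μ : Fin P.d) : Measurable fun U : GaugeField P j U1 => runArg U x μ := by
  unfold runArg
  exact Finset.measurable_sum _ fun t _ => measurable_argB.comp (measurable_toC_apply _)

/-- kernel: the loop variable is a measurable function of the field. [cite: BalabanImbrieJaffe1985, (2.10) p.303] -/
theorem measurable_loopC (c : PBond P (j+1)) (x : Balaban1983to89.Site P j) : Measurable fun U : GaugeField P j U1 => loopC U c x := by
  unfold loopC
  exact (((measurable_holC x).mul (measurable_runC x _)).mul (measurable_holC _).inv).mul (measurable_runC _ _).inv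

/-- kernel: the exponent of (2.10) is measurable (the branch (2.11) is). [cite: BalabanImbrieJaffe1985, (2.11) p.303] -/
theorem measurable_loopAvg (c : PBond P (j+1)) : Measurable fun U : GaugeField P j U1 => loopAvg U c := by
  unfold loopAvg
  exact (Finset.measurable_sum _ fun x _ => measurable_argB.comp (measurable_loopC c x)).const_mul _

/-- **(2.10) is a measurable map `𝒟u`-configurations → `𝒟v`-configurations** (the branch cut of (2.11) is a measurable discontinuity).
[cite: BalabanImbrieJaffe1985, (2.10) p.303] -/
theorem measurable_qU : Measurable (qU : GaugeField P j U1 → GaugeField P (j+1) U1) :=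
  measurable_pi_iff.mpr fun c => measurable_expU1.comp ((measurable_runArg _ _).add (measurable_loopAvg c))

/-- **(2.6) is jointly measurable in `(u, φ)`.** [cite: BalabanImbrieJaffe1985, (2.6) p.303] -/
theorem measurable_qCov :
    Measurable (Function.uncurry (qCov : GaugeField P j U1 → HiggsField P j → HiggsField P (j+1))) := by
  refine measurable_pi_iff.mpr fun y => ?_
  show Measurable fun p : GaugeField P j U1 × HiggsField P j => ((P.L : ℂ) ^ P.d)⁻¹ * ∑ x ∈ block y, holC p.1 x * p.2 x
  exact (Finset.measurable_sum _ fun x _ =>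
    ((measurable_holC x).comp measurable_fst).mul ((measurable_pi_apply x).comp measurable_snd)).const_mul _

/-! ## §5 (3.9)–(3.11): the surface bonds and the substitution `u_b ↦ u_bw_{b′}` on `B^s(b′)` -/

/-- `b = ⟨x, x + e_μ⟩` CROSSES a block face: `x` is at the far position `L − 1` of its block in the direction of the bond, i.e. `b₊` lies in
the adjacent block — `b ∈ B^s(b′)` for the `L`-lattice bond `b′ = ⟨B(b₋), B(b₊)⟩` of (2.15) (`blockOf_tgt_of_isCross`).
[cite: BalabanImbrieJaffe1985, (3.9) p.307] -/
def IsCross (b : PBond P j) : Prop := inBlock b.src b.dir + 1 = P.L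

/-- kernel: crossing is decidable. [cite: BalabanImbrieJaffe1985, (3.9) p.307] -/
instance instDecidablePredIsCross : DecidablePred (IsCross (P := P) (j := j)) := fun b => by
  unfold IsCross; infer_instance

/-- The `L`-lattice bond `b′ = ⟨y, y + e_μ⟩` over a unit bond `b = ⟨x, x + e_μ⟩`, `x ∈ B(y)` (for a crossing bond: the `b′` with
`b ∈ B^s(b′)`). [cite: BalabanImbrieJaffe1985, (3.9) p.307] -/
def coarse (b : PBond P j) : PBond P (j+1) := ⟨blockOf b.src, b.dir⟩

/-- kernel: **a crossing bond joins adjacent blocks**, `blockOf b₊ = blockOf b₋ + e_μ` — with `blockOf b₋ = (coarse b)₋` this is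
`b ∈ B^s(coarse b)` in the sense of (2.15) *"B^s(b′) = {b : b₋ ∈ B(b′₋), b₊ ∈ B(b′₊)}"* (standing range). [cite: BalabanImbrieJaffe1985, (2.15) p.304] -/
theorem blockOf_tgt_of_isCross (hj : j + 1 ≤ P.m + P.K) {b : PBond P j} (hb : IsCross b) :
    blockOf b.tgt = (blockOf b.src).shift b.dir := by
  have e : b.tgt = runSite b.src b.dir 1 := by
    rw [← runSite_shift, runSite_zero]; rfl
  rw [e, runSite_eq_blockSite_hi hj b.src b.dir (t := 1) (by unfold IsCross at hb; omega) (by have := P.hL.2; omega),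
    Balaban1983to89.Site.blockOf_blockSite hj]

/-- kernel: a non-crossing bond stays in its block, `blockOf b₊ = blockOf b₋` (such `b` is in no `B^s(b′)`). [cite: BalabanImbrieJaffe1985, (2.15) p.304] -/
theorem blockOf_tgt_of_not_isCross (hj : j + 1 ≤ P.m + P.K) {b : PBond P j} (hb : ¬ IsCross b) :
    blockOf b.tgt = blockOf b.src := by
  have e : b.tgt = runSite b.src b.dir 1 := by
    rw [← runSite_shift, runSite_zero]; rfl
  have hlt : inBlock b.src b.dir < P.L := Nat.mod_lt _ P.L_pos
  rw [e, blockOf_runSite_lo hj b.src b.dir (t := 1) (by unfold IsCross at hb; omega)]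

/-- The factor of the substitution: `w_{b′}` on the surface bonds `b ∈ B^s(b′)`, `1` elsewhere. [cite: BalabanImbrieJaffe1985, (3.9) p.307] -/
def surfFactor (w : GaugeField P (j+1) U1) (b : PBond P j) : U1 := if IsCross b then w (coarse b) else 1

/-- **The substitution of (3.9)** with a general `L`-lattice field `w`: `(u·w)_b = u_b` if `b ∉ B^s(b′)`, `u_bw_{b′}` if `b ∈ B^s(b′)`
((3.9) is `w = v^{−1}`, `v = Qu`: `uPrime`). [cite: BalabanImbrieJaffe1985, (3.9) p.307] -/
def surfMul (U : GaugeField P j U1) (w : GaugeField P (j+1) U1) : GaugeField P j U1 := fun b => U b * surfFactor w b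

/-- kernel: the substitution off the surface bonds. [cite: BalabanImbrieJaffe1985, (3.9) p.307] -/
theorem surfMul_of_not_isCross (U : GaugeField P j U1) (w : GaugeField P (j+1) U1) {b : PBond P j} (hb : ¬ IsCross b) :
    surfMul U w b = U b := by
  simp [surfMul, surfFactor, hb]

/-- kernel: the substitution on the surface bonds. [cite: BalabanImbrieJaffe1985, (3.9) p.307] -/
theorem surfMul_of_isCross (U : GaugeField P j U1) (w : GaugeField P (j+1) U1) {b : PBond P j} (hb : IsCross b) :
    surfMul U w b = U b * w (coarse b) := by
  simp [surfMul, surfFactor, hb]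

/-- kernel: `u ↦ u·w` is measurable. [cite: BalabanImbrieJaffe1985, (3.9) p.307] -/
theorem measurable_surfMul (w : GaugeField P (j+1) U1) : Measurable fun U : GaugeField P j U1 => surfMul U w :=
  (AveragingRT.measurePreserving_mulRight (P := P) (j := j) (surfFactor w)).measurable

/-- kernel: **`u ↦ u·w` preserves `𝒟u`** (right translation of finitely many Haar variables). [cite: BalabanImbrieJaffe1985, (3.9) p.307] -/
theorem map_surfMul_fieldMeasure (w : GaugeField P (j+1) U1) :
    (fieldMeasure P j U1).map (fun U => surfMul U w) = fieldMeasure P j U1 :=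
  (AveragingRT.measurePreserving_mulRight (P := P) (j := j) (surfFactor w)).map_eq

/-- kernel: the bonds of `Γ_{yx}` are not surface bonds (they stay in the block), so `u(Γ_{yx})` ignores the substitution.
[cite: BalabanImbrieJaffe1985, (3.9) p.307] -/
theorem legProd_surfMul (hj : j + 1 ≤ P.m + P.K) (U : GaugeField P j U1) (w : GaugeField P (j+1) U1) (x : Balaban1983to89.Site P j) (μ : Fin P.d) :
    legProd (surfMul U w) x μ = legProd U x μ := by
  refine prod_congr rfl fun t ht => ?_
  rw [surfMul_of_not_isCross]
  intro hc
  have h := (isAxialBond_legBond hj (mem_range.1 ht)).2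
  unfold IsCross at hc
  change inBlock (legSite x μ t) μ + 1 = P.L at hc
  change inBlock (legSite x μ t) μ + 1 < P.L at h
  omega

/-- kernel: `u(Γ_{yx})` is unchanged by the substitution. [cite: BalabanImbrieJaffe1985, (3.9) p.307] -/
theorem holC_surfMul (hj : j + 1 ≤ P.m + P.K) (U : GaugeField P j U1) (w : GaugeField P (j+1) U1) (x : Balaban1983to89.Site P j) :
    holC (surfMul U w) x = holC U x :=
  prod_congr rfl fun μ _ => legProd_surfMul hj U w x μ

/-- kernel: hence (2.6) ignores the substitution: `Q(u·w)φ = Q(u)φ`. [cite: BalabanImbrieJaffe1985, (3.9) p.307] -/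
theorem qCov_surfMul (hj : j + 1 ≤ P.m + P.K) (U : GaugeField P j U1) (w : GaugeField P (j+1) U1) (φ : HiggsField P j) :
    qCov (surfMul U w) φ = qCov U φ := by
  funext y
  rw [qCov_apply, qCov_apply]
  congr 1
  exact sum_congr rfl fun x _ => by rw [holC_surfMul hj]

/-- kernel: **each straight run of `L` bonds from `x` crosses exactly one block face, at the bond `t = L − 1 − offs x μ`**, and there the
coarse bond is `⟨blockOf x, μ⟩` (standing range). [cite: BalabanImbrieJaffe1985, (3.9) p.307] -/
theorem surfFactor_runBond (hj : j + 1 ≤ P.m + P.K) (w : GaugeField P (j+1) U1) (x : Balaban1983to89.Site P j) (μ : Fin P.d) {t : ℕ}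
    (ht : t < P.L) :
    surfFactor w (runBond x μ t) = if t = P.L - 1 - inBlock x μ then w ⟨blockOf x, μ⟩ else 1 := by
  have hlt : inBlock x μ < P.L := Nat.mod_lt _ P.L_pos
  unfold surfFactor IsCross coarse
  simp only [runBond]
  by_cases hlo : inBlock x μ + t < P.L
  · rw [inBlock_runSite_lo hj x μ hlo, blockOf_runSite_lo hj x μ hlo]
    by_cases he : t = P.L - 1 - inBlock x μ
    · rw [if_pos (by omega), if_pos he]
    · rw [if_neg (by omega), if_neg he]
  · rw [inBlock_runSite_hi hj x μ (by omega) ht.le, if_neg (by omega), if_neg (by omega)]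

/-- kernel: **`u·w(Γ_{xx′}) = u(Γ_{xx′})·w_{⟨B(x), μ⟩}`** — the run picks up exactly one factor `w`. [cite: BalabanImbrieJaffe1985, (3.10) p.307] -/
theorem runC_surfMul (hj : j + 1 ≤ P.m + P.K) (U : GaugeField P j U1) (w : GaugeField P (j+1) U1) (x : Balaban1983to89.Site P j) (μ : Fin P.d) :
    runC (surfMul U w) x μ = runC U x μ * toC (w ⟨blockOf x, μ⟩) := by
  have hlt : inBlock x μ < P.L := Nat.mod_lt _ P.L_pos
  unfold runC
  have e : ∀ t ∈ range P.L, toC (surfMul U w (runBond x μ t)) =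
      toC (U (runBond x μ t)) * (if t = P.L - 1 - inBlock x μ then toC (w ⟨blockOf x, μ⟩) else 1) := by
    intro t ht
    rw [surfMul, toC_mul, surfFactor_runBond hj w x μ (mem_range.1 ht)]
    split_ifs <;> simp [toC_one]
  rw [prod_congr rfl e, prod_mul_distrib, prod_ite_eq' (range P.L) (P.L - 1 - inBlock x μ) (fun _ => toC (w ⟨blockOf x, μ⟩)),
    if_pos (mem_range.2 (by omega))]

/-- kernel: **the loop of (2.10) is unchanged by the substitution** — it contains one surface bond of `B^s(b′)` forwards (in `Γ_{xx′}`) and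
one backwards (in `Γ_{y′y}`), whatever the branch of the logarithm (`x ∈ B(y)`, standing range). [cite: BalabanImbrieJaffe1985, (3.11) p.307] -/
theorem loopC_surfMul (hj : j + 1 ≤ P.m + P.K) (U : GaugeField P j U1) (w : GaugeField P (j+1) U1) (c : PBond P (j+1))
    {x : Balaban1983to89.Site P j} (hx : x ∈ block c.src) : loopC (surfMul U w) c x = loopC U c x := by
  have hy : blockOf x = c.src := mem_block_iff.1 hx
  unfold loopC
  rw [holC_surfMul hj, holC_surfMul hj, runC_surfMul hj, runC_surfMul hj, hy, blockOf_corner hj]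
  have h1 := toC_ne_zero (w ⟨c.src, c.dir⟩)
  have h5 := holC_ne_zero U x
  have h6 := holC_ne_zero U (runSite x c.dir P.L)
  have h7 := runC_ne_zero U x c.dir
  have h8 := runC_ne_zero U (corner c.src) c.dir
  field_simp

/-- kernel: hence the exponent of (2.10) is unchanged by the substitution. [cite: BalabanImbrieJaffe1985, (3.11) p.307] -/
theorem loopAvg_surfMul (hj : j + 1 ≤ P.m + P.K) (U : GaugeField P j U1) (w : GaugeField P (j+1) U1) (c : PBond P (j+1)) :
    loopAvg (surfMul U w) c = loopAvg U c := by
  unfold loopAvg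
  congr 1
  exact sum_congr rfl fun x hx => by rw [loopC_surfMul hj U w c hx]

/-- **`Q(u·w) = (Qu)·w`** — the substitution `u_b ↦ u_bw_{b′}` on the surface bonds multiplies the block average (2.10) by `w_{b′}`, EXACTLY
and for every branch of the logarithm (the mechanism of (3.9)–(3.11); standing range). [cite: BalabanImbrieJaffe1985, (3.11) p.307] -/
theorem qU_surfMul (hj : j + 1 ≤ P.m + P.K) (U : GaugeField P j U1) (w : GaugeField P (j+1) U1) :
    qU (surfMul U w) = fun c => qU U c * w c := by
  funext c
  apply toC_injective_U1
  rw [toC_mul, toC_qU, toC_qU, loopAvg_surfMul hj, runC_surfMul hj, blockOf_corner hj]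
  ring

/-- **(3.9)** *"(u′)_b = u_b, if b ∉ B^s(b′); u_bv_{b′}^{−1}, if b ∈ B^s(b′)"* with **(3.10)** `v_{b′} = (Qu)_{b′}`: the field with unit block
averages. (The `ℤ^d` decl of record is p03's `BIJ85Eq311Proof.uPrime`, filed.) [cite: BalabanImbrieJaffe1985, (3.9) p.307] -/
def uPrime (U : GaugeField P j U1) : GaugeField P j U1 := surfMul U (fun c => (qU U c)⁻¹)

/-- **(3.11)** *"It then follows that (Qu′)_{b′} = 1 for all L-lattice bonds b′"* — PROVED (standing range). [cite: BalabanImbrieJaffe1985, (3.11) p.307] -/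
theorem qU_uPrime (hj : j + 1 ≤ P.m + P.K) (U : GaugeField P j U1) : qU (uPrime U) = 1 := by
  unfold uPrime
  rw [qU_surfMul hj]
  funext c
  exact mul_inv_cancel (qU U c)

/-! ## §6 The Haar law of (2.10): `law(Qu) = 𝒟v`, also in the axial gauge of (3.4) -/

/-- **HAAR UNIQUENESS STEP.**  Every probability law `ν` of unit-lattice configurations that is invariant under all the substitutions
`u ↦ u·w` (3.9) is pushed by `Q` (2.10) to the product Haar measure `𝒟v` of the `L`-lattice: `Q_*ν` is invariant under right
translations (`qU_surfMul`), `𝒟v` under left translations, and a translation-invariant probability law on the compact group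
`U(1)^{bonds}` is Haar measure (`AveragingRT.measure_eq_mass_smul_of_invariant`). [cite: BalabanImbrieJaffe1985, (3.11) p.307] -/
theorem map_qU_eq_of_invariant (hj : j + 1 ≤ P.m + P.K) (ν : Measure (GaugeField P j U1)) [IsProbabilityMeasure ν]
    (hν : ∀ w : GaugeField P (j+1) U1, ν.map (fun U => surfMul U w) = ν) :
    ν.map qU = fieldMeasure P (j+1) U1 := by
  letI : Group (GaugeField P (j+1) U1) := Pi.group
  letI : MeasurableMul₂ (GaugeField P (j+1) U1) := Pi.measurableMul₂
  have hmeas : Measurable (qU : GaugeField P j U1 → GaugeField P (j+1) U1) := measurable_qU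
  haveI : IsProbabilityMeasure (ν.map (qU : GaugeField P j U1 → GaugeField P (j+1) U1)) :=
    Measure.isProbabilityMeasure_map hmeas.aemeasurable
  have h := AveragingRT.measure_eq_mass_smul_of_invariant (fieldMeasure P (j+1) U1) (ν.map qU) ?_ ?_
  · rw [h, measure_univ, one_smul]
  · intro g
    exact (AveragingRT.measurePreserving_mulLeft (P := P) (j := j+1) g).map_eq
  · intro g
    have hcomp : ((fun x => x * g) ∘ (qU : GaugeField P j U1 → GaugeField P (j+1) U1)) = qU ∘ fun U => surfMul U g := by
      funext U
      show (fun c => qU U c * g c) = qU (surfMul U g)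
      rw [qU_surfMul hj]
    calc (ν.map qU).map (fun x => x * g)
        = ν.map ((fun x => x * g) ∘ qU) := Measure.map_map (measurable_mul_const g) hmeas
      _ = ν.map (qU ∘ fun U => surfMul U g) := by rw [hcomp]
      _ = (ν.map fun U => surfMul U g).map qU := (Measure.map_map hmeas (measurable_surfMul g)).symm
      _ = ν.map qU := by rw [hν g]

/-- **`law(Qu) = 𝒟v` under `𝒟u`**: the block average (2.10) pushes the product Haar measure of the unit lattice to the product Haar
measure of the `L`-lattice (standing range). [cite: BalabanImbrieJaffe1985, (3.11) p.307] -/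
theorem map_qU_fieldMeasure (hj : j + 1 ≤ P.m + P.K) :
    (fieldMeasure P j U1).map qU = fieldMeasure P (j+1) U1 :=
  map_qU_eq_of_invariant hj _ map_surfMul_fieldMeasure

/-- kernel: **the substitution (3.9) commutes with the axial gauge fix (3.4)** — the frozen tree bonds are intra-block, the substitution
touches only surface bonds (any decidability instance for the freezing). [cite: BalabanImbrieJaffe1985, (3.9) p.307] -/
theorem fixBonds_surfMul {inst : DecidableEq (PBond P j)} (U : GaugeField P j U1)
    (w : GaugeField P (j+1) U1) :
    fixBonds axialBonds (surfMul U w) = surfMul (fixBonds axialBonds U) w := by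
  funext b
  by_cases hb : b ∈ (axialBonds : Finset (PBond P j))
  · have hnc : ¬ IsCross b := by
      have h := (mem_axialBonds.1 hb).2
      unfold IsCross
      omega
    rw [fixBonds_apply_of_mem hb, surfMul_of_not_isCross _ _ hnc, fixBonds_apply_of_mem hb]
  · rw [fixBonds_apply_of_not_mem hb]
    simp only [surfMul, fixBonds_apply_of_not_mem hb]

/-- kernel: the law of `u[T := 1]` (r18's `axialMeasure`, any decidability instance) is invariant under the substitutions.
[cite: BalabanImbrieJaffe1985, (3.9) p.307] -/
theorem map_surfMul_map_fixBonds {inst : DecidableEq (PBond P j)} (w : GaugeField P (j+1) U1) :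
    ((fieldMeasure P j U1).map (fixBonds axialBonds)).map (fun U => surfMul U w) =
      (fieldMeasure P j U1).map (fixBonds axialBonds) := by
  have hfix : Measurable (fixBonds (axialBonds : Finset (PBond P j)) : GaugeField P j U1 → GaugeField P j U1) :=
    @measurable_fixBonds P j U1 _ _ inst axialBonds
  rw [Measure.map_map (measurable_surfMul w) hfix]
  have e : ((fun U => surfMul U w) ∘ fixBonds (axialBonds : Finset (PBond P j))) =
      fixBonds axialBonds ∘ fun U : GaugeField P j U1 => surfMul U w := by
    funext U
    exact (fixBonds_surfMul U w).symm
  rw [e, ← Measure.map_map hfix (measurable_surfMul w), map_surfMul_fieldMeasure]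

/-- kernel: the Haar law in the axial gauge, instance-generic form. [cite: BalabanImbrieJaffe1985, (3.11) p.307] -/
theorem map_qU_map_fixBonds (hj : j + 1 ≤ P.m + P.K) {inst : DecidableEq (PBond P j)} :
    ((fieldMeasure P j U1).map (fixBonds axialBonds)).map qU = fieldMeasure P (j+1) U1 := by
  haveI : IsProbabilityMeasure ((fieldMeasure P j U1).map (fixBonds (axialBonds : Finset (PBond P j)))) :=
    Measure.isProbabilityMeasure_map (@measurable_fixBonds P j U1 _ _ inst axialBonds).aemeasurable
  exact map_qU_eq_of_invariant hj _ map_surfMul_map_fixBonds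

/-- **`law(Qu) = 𝒟v` IN THE AXIAL GAUGE**: under `∫𝒟u δ_{Ax}(u)(·)` (r18's `axialMeasure` = the law of `u[T := 1]`, (3.4)) the block
average (2.10) is distributed according to the product Haar measure `𝒟v` of the `L`-lattice — the fact behind *"δ(v/Qu) is a delta
function which specifies that the average gauge field in each block B(y) is v"* being a DENSITY w.r.t. `𝒟v` (standing range).
[cite: BalabanImbrieJaffe1985, (3.11) p.307] -/
theorem map_qU_axialMeasure (hj : j + 1 ≤ P.m + P.K) :
    (axialMeasure P j U1).map qU = fieldMeasure P (j+1) U1 := by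
  unfold axialMeasure
  exact map_qU_map_fixBonds hj

/-- **The Haar regularity `hac` of `BIJ88RT311Exists.axialRTData` / `ac_qU` of `BIJ85RT33.RTData` HOLDS for the printed average (2.10)**:
`(∫𝒟u δ_{Ax}(u)·).map Q ≪ 𝒟v` (indeed `=`; standing range) — GAPS.md G-C2-04 discharged for the model.
[cite: BalabanImbrieJaffe1988, (3.11) p.266] -/
theorem absolutelyContinuous_map_qU (hj : j + 1 ≤ P.m + P.K) :
    (axialMeasure P j U1).map qU ≪ fieldMeasure P (j+1) U1 := by
  rw [map_qU_axialMeasure hj]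

/-! ## §7 [BalabanImbrieJaffe1988] (3.11) for the printed block averages: `ρ₁^L` exists, and (3.13) for it -/

/-- **The block-averaging datum of [BalabanImbrieJaffe1988] (3.11) with EVERYTHING concrete**: `δ_{Ax}` = (3.4) on the torus (r18's `axialBonds`),
`Qu` = (2.10)–(2.11) (`qU`), `Q(u)φ` = (2.6) (`qCov`), Haar regularity PROVED (`absolutelyContinuous_map_qU`) — an inhabitant of p34's
`BIJ85RT33.RTData` with no hypothesis left (standing range). [cite: BalabanImbrieJaffe1988, (3.11) p.266] -/
def torusRTData (hj : j + 1 ≤ P.m + P.K) : BIJ85RT33.RTData P j :=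
  axialRTData hj qU measurable_qU qCov measurable_qCov (absolutelyContinuous_map_qU hj)

/-- kernel: the datum freezes r18's `axialBonds`. [cite: BalabanImbrieJaffe1988, (3.11) p.266] -/
@[simp] theorem torusRTData_tree (hj : j + 1 ≤ P.m + P.K) : (torusRTData (P := P) hj).tree = axialBonds := rfl

/-- kernel: the datum's gauge-field average IS (2.10). [cite: BalabanImbrieJaffe1988, (3.11) p.266] -/
@[simp] theorem torusRTData_qU (hj : j + 1 ≤ P.m + P.K) : (torusRTData (P := P) hj).qU = qU := rfl

/-- kernel: the datum's scalar average IS (2.6). [cite: BalabanImbrieJaffe1988, (3.11) p.266] -/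
@[simp] theorem torusRTData_qH (hj : j + 1 ≤ P.m + P.K) : (torusRTData (P := P) hj).qH = qCov := rfl

/-- **(3.11) of [BalabanImbrieJaffe1988] HOLDS FOR THE PRINTED BLOCK AVERAGES, with a CONSTRUCTED `ρ₁^L`.**  For `a > 0`, `d ≥ 2` (standing range) and
every density `ρ₀(u, φ)` that is jointly measurable, jointly gauge invariant and `𝒟u𝒟φ`-integrable, the measure-level renormalization
transform `ρ₁ := 𝒯ρ₀` of [BalabanImbrieJaffe1985] (3.3) (p34's Radon–Nikodym `RTData.rt` with `δ_H` = r18's normalized Gaussian (3.12))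
satisfies r18's typed (3.11) `IsRT311 Q Q(·)φ a ρ₀ ρ₁` with `Q` = (2.10)–(2.11) and `Q(u)φ` = (2.6): `∫dv dψ ρ₁ g = ∫𝒟u δ_{Ax}(u)∫𝒟φ∫dψ ρ₀
e^{−½aL⁻²⟨ψ−Q(u)φ,ψ−Q(u)φ⟩−E^{(0)}} g(Qu, ψ)` for all bounded measurable `g` — NO hypothesis on the block averages remains (p34's
`isRT311_axialRTData` ∘ `absolutelyContinuous_map_qU`). [cite: BalabanImbrieJaffe1988, (3.11) p.266] -/
theorem isRT311_model (hj : j + 1 ≤ P.m + P.K) {a : ℝ} (ha : 0 < a) (hd : 2 ≤ P.d)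
    {ρ : GaugeField P j U1 → HiggsField P j → ℂ} (hρm : Measurable (Function.uncurry ρ)) (hρg : JointInvariant ρ)
    (hρi : Integrable (Function.uncurry ρ) ((fieldMeasure P j U1).prod volume)) :
    IsRT311 qU qCov a ρ ((torusRTData hj).rt (gaussApprox ha hd) ρ) :=
  isRT311_axialRTData hj ha hd measurable_qU measurable_qCov (absolutelyContinuous_map_qU hj) hρm hρg hρi

/-- **EXISTENCE of `ρ₁^L` in (3.11) for the model's block averages**, with `dv dψ`-integrability of the density (p34's
`integrable_rt_of_integrable_ax`). [cite: BalabanImbrieJaffe1988, (3.11) p.266] -/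
theorem exists_isRT311 (hj : j + 1 ≤ P.m + P.K) {a : ℝ} (ha : 0 < a) (hd : 2 ≤ P.d)
    {ρ : GaugeField P j U1 → HiggsField P j → ℂ} (hρm : Measurable (Function.uncurry ρ)) (hρg : JointInvariant ρ)
    (hρi : Integrable (Function.uncurry ρ) ((fieldMeasure P j U1).prod volume)) :
    ∃ ρ₁ : GaugeField P (j+1) U1 → HiggsField P (j+1) → ℂ,
      IsRT311 qU qCov a ρ ρ₁ ∧ Integrable (Function.uncurry ρ₁) ((fieldMeasure P (j+1) U1).prod volume) :=
  ⟨_, isRT311_model hj ha hd hρm hρg hρi,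
    integrable_rt_of_integrable_ax (D := torusRTData hj) (A := gaussApprox ha hd) hρm
      (BIJ85RT37Normalization.integrable_comp_ax hρm hρg hρi)⟩

/-- **(3.13) for the constructed density over the printed averages**: `[F] = ∫dv dψ ρ₁^L(v, ψ)` with `ρ₁^L = 𝒯ρ₀`, `ρ₀ = F e^{−S}` the
model's density (r18's `rho0`), for every jointly measurable, jointly gauge-invariant observable `F` with `𝒟u𝒟φ`-integrable `ρ₀`
(r18's `eq313` ∘ p34's `eq313_rt`, block averages (2.6)/(2.10); standing range, `a > 0`, `ε > 0`, `d ≥ 2`).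
[cite: BalabanImbrieJaffe1988, (3.13) p.267] -/
theorem eq313_model (hj : j + 1 ≤ P.m + P.K) (hd : 2 ≤ P.d) {a ε : ℝ} (ha : 0 < a) (hε : 0 < ε) (e lam dm2 E₀ E₁ : ℝ)
    {F : GaugeField P j U1 → HiggsField P j → ℂ} (hFm : Measurable (Function.uncurry F)) (hFg : JointInvariant F)
    (hFi : Integrable (Function.uncurry (rho0 ε e lam dm2 E₀ E₁ F)) ((fieldMeasure P j U1).prod volume)) :
    bracket (actionU1 (ε ^ P.d) ε⁻¹ e lam dm2 E₀ E₁) F =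
      ∫ v, ∫ ψ, (torusRTData hj).rt (gaussApprox ha hd) (rho0 ε e lam dm2 E₀ E₁ F) v ψ ∂volume ∂fieldMeasure P (j+1) U1 :=
  eq313_rt hj hd ha hε e lam dm2 E₀ E₁ (torusRTData hj) rfl hFm hFg hFi

/-! ## §8 (v1.1) (2.9) `QQ^* = I` for the concrete (2.6); (3.11)/(3.13) with all analytic hypotheses discharged -/

/-- kernel: `|u(Γ_{yx})| = 1`. [cite: BalabanImbrieJaffe1985, (2.5) p.302] -/
theorem norm_holC (U : GaugeField P j U1) (x : Balaban1983to89.Site P j) : ‖holC U x‖ = 1 := by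
  unfold holC legProd
  rw [norm_prod]
  refine prod_eq_one fun μ _ => ?_
  rw [norm_prod]
  exact prod_eq_one fun t _ => norm_toC _

/-- The transport `u(Γ_{yx})` as an element of the unit circle (the `τ_x` of r15's `BIJ85CellAverages.Cells.Qcov`).
[cite: BalabanImbrieJaffe1985, (2.6) p.303] -/
def holCircle (U : GaugeField P j U1) (x : Balaban1983to89.Site P j) : Circle :=
  ⟨holC U x, mem_sphere_zero_iff_norm.2 (norm_holC U x)⟩

/-- kernel: `holCircle` read in `ℂ` is `holC`. [cite: BalabanImbrieJaffe1985, (2.6) p.303] -/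
@[simp] theorem coe_holCircle (U : GaugeField P j U1) (x : Balaban1983to89.Site P j) : (holCircle U x : ℂ) = holC U x := rfl

/-- **The two-scale cell geometry of (2.6) on the torus** — an instance of r15's `BIJ85CellAverages.Cells` (fine cells = sites of `T₁`,
coarse cells = sites of the `L`-lattice, `x ∈ B(blockOf x)`, exponent `m = 0`, block size `L`, dimension `d`).
[cite: BalabanImbrieJaffe1985, (2.6) p.303] -/
def torusCells (P : Params) (j : ℕ) : BIJ85CellAverages.Cells where
  F := Balaban1983to89.Site P j
  C := Balaban1983to89.Site P (j+1)
  cell := fun x => some (blockOf x)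
  L := P.L
  d := P.d
  m := 0
  one_le_L := P.L_pos
  m_le_d := Nat.zero_le _

/-- kernel: the block sets of `torusCells` are the blocks `B(y)` of `Setup`. [cite: BalabanImbrieJaffe1985, (2.4) p.302] -/
theorem torusCells_B (y : Balaban1983to89.Site P (j+1)) : (torusCells P j).B y = block y := by
  ext x
  rw [BIJ85CellAverages.Cells.mem_B]
  show some (blockOf x) = some y ↔ x ∈ block y
  exact Option.some_inj.trans (mem_block_iff (P := P) (j := j) (x := x) (y := y)).symm

/-- kernel: **the concrete (2.6) IS r15's cell average** with the transports `u(Γ_{yx})`: `qCov U φ = Cells.Qcov (holCircle U) φ`.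
[cite: BalabanImbrieJaffe1985, (2.6) p.303] -/
theorem qCov_eq_cellsQcov (U : GaugeField P j U1) (φ : HiggsField P j) (y : Balaban1983to89.Site P (j+1)) :
    qCov U φ y = (torusCells P j).Qcov (holCircle U) φ y := by
  rw [qCov_apply, BIJ85CellAverages.Cells.Qcov, torusCells_B]
  rfl

/-- **(2.9)** *"A further property of Q is that QQ^* = I, (2.9) where Q^* is the adjoint in the scalar product (2.2)"* — PROVED for the
CONCRETE average (2.6) on the torus: `Q(u)(Q(u)^*ψ) = ψ` with `Q(u)^*` = r15's `Cells.QcovStar` (the adjoint, `inner_qCov_eq_inner_qCovStar`), from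
r15's `Cells.Qcov_QcovStar` and `|B(y)| = L^d` (`Site.card_block`; standing range). [cite: BalabanImbrieJaffe1985, (2.9) p.303] -/
theorem qCov_qCovStar (hj : j + 1 ≤ P.m + P.K) (U : GaugeField P j U1) (ψ : HiggsField P (j+1)) (y : Balaban1983to89.Site P (j+1)) :
    qCov U ((torusCells P j).QcovStar (holCircle U) ψ) y = ψ y := by
  rw [qCov_eq_cellsQcov]
  exact (torusCells P j).Qcov_QcovStar (fun y' => by rw [torusCells_B]; exact Balaban1983to89.Site.card_block hj y') _ ψ y

/-- kernel: `Q(u)^*` IS the adjoint of the concrete (2.6) for the scalar products (2.2) (weights `L^d` on the `L`-lattice, `1` on the unit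
lattice) — r15's `Cells.inner_Qcov_eq_inner_QcovStar` on the torus instance. [cite: BalabanImbrieJaffe1985, (2.9) p.303] -/
theorem inner_qCov_eq_inner_qCovStar (U : GaugeField P j U1) (φ : HiggsField P j) (ψ : HiggsField P (j+1)) :
    BIJ85CellAverages.Cells.innerC ((P.L : ℂ) ^ P.d) (qCov U φ) ψ =
      BIJ85CellAverages.Cells.innerC 1 φ ((torusCells P j).QcovStar (holCircle U) ψ) := by
  have e : qCov U φ = (torusCells P j).Qcov (holCircle U) φ := funext fun y => qCov_eq_cellsQcov U φ y
  rw [e]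
  exact (torusCells P j).inner_Qcov_eq_inner_QcovStar (holCircle U) φ ψ

/-- **[BalabanImbrieJaffe1988] (3.11) FOR THE PRINTED MODEL AND OBSERVABLES, every analytic hypothesis discharged**: for `ε > 0`, `λ > 0`, `a > 0`,
`d ≥ 2` (standing range) and every observable `F` that is jointly measurable, jointly gauge invariant (p. 265 *"F is a gauge invariant function
of u, φ"*) and of polynomial growth `|F(u, φ)| ≤ CΠ_x(1 + |φ(x)|)ⁿ` (all products of the factors of (3.1)), the density `ρ₁^L := 𝒯ρ₀`
(p34's `RTData.rt` over `torusRTData`, `ρ₀ = F e^{−S}` = r18's `rho0`) satisfies r18's typed (3.11) `IsRT311 qU qCov a ρ₀ ρ₁` with the block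
averages (2.6)/(2.10) of this file — integrability from r18's `BIJ88Rho0Integrable.integrable_rho0`. [cite: BalabanImbrieJaffe1988, (3.11) p.266] -/
theorem isRT311_printed (hj : j + 1 ≤ P.m + P.K) (hd : 2 ≤ P.d) {a ε : ℝ} (ha : 0 < a) (hε : 0 < ε) (e : ℝ) {lam : ℝ}
    (hlam : 0 < lam) (dm2 E₀ E₁ : ℝ) {F : GaugeField P j U1 → HiggsField P j → ℂ} (hFm : Measurable (Function.uncurry F))
    (hFg : JointInvariant F) {C : ℝ} {n : ℕ}
    (hF : ∀ U φ, ‖F U φ‖ ≤ C * ∏ x : Balaban1983to89.Site P j, (1 + ‖φ x‖) ^ n) :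
    IsRT311 qU qCov a (rho0 ε e lam dm2 E₀ E₁ F) ((torusRTData hj).rt (gaussApprox ha hd) (rho0 ε e lam dm2 E₀ E₁ F)) :=
  isRT311_model hj ha hd (BIJ88RenormTransf311.measurable_rho0 ε e lam dm2 E₀ E₁ hFm)
    (fun g U φ => BIJ88RenormTransf311.rho0_gaugeAct ε e lam dm2 E₀ E₁ hFg g U φ)
    (BIJ88Rho0Integrable.integrable_rho0 hε e hlam dm2 E₀ E₁ hFm hF)

/-- **[BalabanImbrieJaffe1988] (3.13) `[F] = ∫dv dψ ρ₁^L(v, ψ)` FOR THE PRINTED MODEL AND OBSERVABLES, every analytic hypothesis discharged** (r18's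
`eq313` ∘ p34's RN existence ∘ this file's block averages and Haar law ∘ r18's `integrable_rho0`): premises `ε > 0`, `λ > 0`, `a > 0`, `d ≥ 2`,
`F` jointly measurable, jointly gauge invariant, `|F(u, φ)| ≤ CΠ_x(1 + |φ(x)|)ⁿ`. [cite: BalabanImbrieJaffe1988, (3.13) p.267] -/
theorem eq313_printed (hj : j + 1 ≤ P.m + P.K) (hd : 2 ≤ P.d) {a ε : ℝ} (ha : 0 < a) (hε : 0 < ε) (e : ℝ) {lam : ℝ}
    (hlam : 0 < lam) (dm2 E₀ E₁ : ℝ) {F : GaugeField P j U1 → HiggsField P j → ℂ} (hFm : Measurable (Function.uncurry F))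
    (hFg : JointInvariant F) {C : ℝ} {n : ℕ}
    (hF : ∀ U φ, ‖F U φ‖ ≤ C * ∏ x : Balaban1983to89.Site P j, (1 + ‖φ x‖) ^ n) :
    bracket (actionU1 (ε ^ P.d) ε⁻¹ e lam dm2 E₀ E₁) F =
      ∫ v, ∫ ψ, (torusRTData hj).rt (gaussApprox ha hd) (rho0 ε e lam dm2 E₀ E₁ F) v ψ ∂volume ∂fieldMeasure P (j+1) U1 :=
  eq313_model hj hd ha hε e lam dm2 E₀ E₁ hFm hFg (BIJ88Rho0Integrable.integrable_rho0 hε e hlam dm2 E₀ E₁ hFm hF)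

end

end Literature.MathematicalPhysics.QuantumFieldTheory.BalabanImbrieJaffe1984to88.BIJ85BlockAveragesTorus
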